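import Summits.QuantumFields.YangMills.Theorems.BalabanUVNodesN26AtRecord11
import Literature.MathematicalPhysics.QuantumFieldTheory.Balaban1983to89.Node00.Record13
import Literature.MathematicalPhysics.QuantumFieldTheory.Balaban1983to89.Node00.Record13SepCoPH
import Summits.QuantumFields.YangMills.Theses.BalabanUVNodes
import Summits.QuantumFields.BalabanUV.Gaps.CapSignsConstRoad
import Summits.QuantumFields.BalabanUV.Gaps.D1Residue
import Summits.QuantumFields.YangMills.Theorems.BalabanUVNodesK2Line2SlopeGuardPrice
import Summits.QuantumFields.YangMills.Theorems.BalabanUVNodesK2Line1PrimeRemainderPrice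
import Summits.QuantumFields.YangMills.Theorems.BalabanUVNodesK2NamedJetsRunRemAt

/-!
# Crux K2⁷ `EndpointGivenBR13SepCoPH` — idea card «threshold-slide-comparison» (seat ym-nodeO-idea-1, gen 2 → gen 4): SKETCH, EDITION 6
# EDITION 6 (gen 4, 2026-08-28T03:xxZ) = edition 5 UNCHANGED (§§1–9) + §10 ALIGNMENT WITH THE REGISTERED SKELETON v6 (plan g82 `K2Skeleton13SepCoPHv6.lean`
# sha16 5a75a2378c79b303, director-ym №206 GO): v6's two registered stub texts `RunRemAtSomeJets` (2ᴮ″, XL) ∕ `D1AtAnchoredJets` (1ᴬ, L) copied VERBATIM into `V6.*`;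
# `d1AtAnchorJets13_iff_v6 : D1AtAnchorJets13 ↔ V6.D1AtAnchoredJets := Iff.rfl`; idea-1's run-wise road typed as a SUPPLIER ROAD of v6's XL stub BY NAME
# (`runRemAtSomeJets_v6_of_runSlide : AnchorJets13 → RunThresholdCorner13 → RunFrozenFamilyAnchored13 → ContRun13 → V6.RunRemAtSomeJets`); v6's pair concluder
# re-proved over the copies and the composition `EndpointGivenBR13SepCoPH_of_runThresholdSlide_v6` factored through it (kernel, 0 sorry).
# EDITION 5 (gen 3, 2026-08-28T02:5xZ) = edition 4 UNCHANGED (§§1–8) + §9 THE RUN-WISE RE-KEY required by CRIT-1 g4's BN-F addendum: the registration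
# texts are now (A) `AnchorJets13` · (TI-min)ᴿ `RunThresholdCorner13` · (FFᴺ)ᴿ `RunFrozenFamilyAnchored13` · (C)ᴿ `ContRun13` · (D1-A) `D1AtAnchorJets13`,
# all keyed on the crux's FULL prefix as in plan g82's registered skeleton v5 (`K2Skeleton13SepCoPHv5.lean` 16e2ea6200bb4554, DECISION №204), composing to K2⁷ BY NAME
# POINTWISE via p596574 `endpointExistence_of_runRemAt_drift` (`EndpointGivenBR13SepCoPH_of_runThresholdSlide`, kernel, 0 sorry; NO (UP) stub; every ed.5 text weaker
# BY NAME than its ed.4 box text, §9b).  The skeleton's own BN-F re-key is plan's cut (director №24); this file only supplies texts.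
# The (2.9) threshold of the record is SLID: an OPEN-letter threshold family below `θ.ε₂₉`, a k-uniform COMPARISON of the record's merged β with
# the family (threshold insensitivity, Gaussian annulus weight), and print's ε₁-FROZEN remainder bound read along the family ⟹ the (D4) smallness
# AT THE RECORD's FIXED THRESHOLD ⟹ K2⁷ BY NAME through `Gaps.D1Residue.endpointExistence_of_residue` (kernel-checked composition, 0 sorry).

Cell `ym-nodeO-ideate`, IDEATOR seat `ym-nodeO-idea-1` (gen 2, lens ideate-on-items: the D1 ∕ D4 ∕ CAP ∕ GAN24 items held by the b2b crews), crux
item stmt-QuantumFields-20543, decl `Summit.QuantumFields.YangMills.Theses.BalabanUVNodes.EndpointGivenBR13SepCoPH`, route `BalabanUVNodes` (R4).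
A SKETCH for the critic `ym-nodeO-crit-1`: hypothesis SHAPES (`def … : Prop`) + kernel bookkeeping; NO stub is proved, NOTHING of Bałaban's analysis is
asserted; this is NOT a registered skeleton (the skeleton of record is plan g79's `K2Skeleton13SepCoPHv2.lean`, sha16 4bf42851e4bc388d).

THE LEVER.  In the Stage-13 record the (2.9) small-field threshold `ε₂₉` enters the β of record ONLY through the coupling-blind fluctuation cut-off
`chiFixed29 F 2 θ.ν θ.ε₂₉` of the merged term (`Node00/SmallFieldChi29OfRecord.lean`, `Node00/Record13.lean` §3; [I] (2.9) p. 266 prints a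
g-INDEPENDENT threshold «∏ χ({|B′(b)| < ε₁})»).  Read the same slots at a SMALLER threshold letter `e ≤ θ.ε₂₉`:
`betaAt F θ e := betaMerged F (mergedTermFamilyMatT F 2 (TcanOfRecord F 2) (chiFixed29 F 2 θ.ν e) θ.εbg) θ.ρ8 θ.bV` (§2; `betaAt F θ θ.ε₂₉` IS the
record's merged β, `rfl`).  Two located hypothesis shapes:
* (TI) `ThresholdInsensitive13` — k-UNIFORM THRESHOLD INSENSITIVITY: on `]0,γ′]`-histories, `|β_θ − β_e| ≤ A·exp(−c·(e∕γ′)²)` (the two small-field flows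
  differ by fluctuation configurations in the annulus `e ≤ |B′(b)| < ε₂₉`, of Gaussian weight `exp(−O(1)e²∕g_j²)` at scale `j`; k-uniformity = fading
  memory of the DIFFERENCE flow under [I] Thm 3's inductive bounds).  Bałaban flags exactly this degree of freedom: [I] p. 266 after (2.9) «Another
  possibility is to take g_kγ_kε₁ instead of ε₁ … It has the advantage that the functions E^{(j)}, β_j are analytic functions of the effective coupling
  constants»; here the remark is used as a COMPARISON of two legal small-field flows, not as a re-derivation of the expansion.  NOT PRINTED as a
  difference estimate; size XL; nearest tree genre `Node00/BetaTransportComparison.lean` (β-comparison under a transport change; locality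
  `polTensor_congr_of_eventuallyEq`) and `B14DeltaBeta.lean` (C14: δβ = a difference of two (1.20)–(1.22) instances).
* (FF) `FrozenFamilyOfD1Record13` — PRINT's ε₁-FROZEN (D4) BOUND READ ALONG THE OPEN-LETTER FAMILY, minimal form: for every `r > 0` SOME threshold
  `e ≤ θ.ε₂₉` and SOME box `]0,γ_e] ⊆ ]0,θ.γ]` with `|β_e − β⁰| ≤ r` there, `β⁰_k = secondMoment (TbalOf Lc Js k) 0 1` the (D1) datum's one-loop numbers
  ([II] = [Balaban1988RG2Cluster] Lemma 3 (2.38) p. 20 → [I] (5.10) p. 293 → (1.22) p. 264: remainder constant `r = ε₁·K`, vanishing WITH THE THRESHOLD;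
  [I] Thm 3 p. 264 «γ … depends on all other constants» = the member's own window).  = the (D4) crew's deliverable in the OPEN-letter form the
  b2b READ RULE already prescribes (ref-D READ-148: «a (D4)∕N26 theorem feeding this stub must take ε₂₉ as an ARGUMENT of an OPEN-letter family»;
  `Beta/RemainderResidueFamily.lean` `ObjectsFamily[Cont]`), WITHOUT any g-resolution of the remainder and WITHOUT a window rate.
THE JUNCTION (§1, elementary real analysis, PROVED): given `s > 0` take `r := s∕2`, its member `(e, γ_e)`, and shrink the box to
`γ₀ := min γ_e (e·t)`, `t := min 1 (s·c∕(2A))`; then `exp(−x) ≤ 1∕x` gives `A·exp(−c(e∕γ₀)²) ≤ A·γ₀²∕(c·e²) ≤ A·t∕c ≤ s∕2`, so `|β_θ − β⁰| ≤ s` on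
`]0,γ₀]` — the CONSTANT-REMAINDER smallness of the record's DEFINITIONAL split AT THE RECORD's OWN THRESHOLD at every slope, in particular at the (D1)
slope `stepBal Nc Lc > 0`; with row (D1)'s residue and box continuity this is `D1Residue.endpointExistence_of_residue` BY NAME (§5).
WHAT THIS BUYS (the point of the card): the ∀θ crux K2⁷ fixes the threshold slot, so an open-letter (D4) family alone serves only pick-a-member (∃θ)
statements (`exists_member_thm2Printed_of_beta0Floor`, K0's 3ᴬ); (TI) is the TRANSFER PRINCIPLE that lets print's frozen, open-letter product close K2⁷ at
the given θ — replacing every g-RESOLUTION currency in play on this crux (AF-1 `BoxRemainder`∕`BetaRemainderH`, the (190)-chain `AtSlopeCont` at the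
record, N17's scale-shift rate) by ε-RESOLUTION + COMPARISON.

STUB SET OF THE LINE (5; 2 new): `D1AtRecord13` (shared, v2 verbatim) · `SlopePosOfD1Record13` (shared, v2 verbatim) · `ThresholdInsensitive13` (NEW, XL,
load-bearing) · `FrozenFamilyOfD1Record13` (NEW shape of the (D4) open-letter product, L–XL) · `ContRecord13` (shared, v2 verbatim).
HONEST FRAMING: nothing of Bałaban's is asserted or proved; (TI) is NOT PRINTED; (FF) is print's Lemma 3∕(5.10)∕(1.22) chain whose k-uniform (D4) estimate
is the cell's located gap (GAPS G-b12-2, BINDER-OWNERS row D4); K2⁷ OPEN; counts unmoved; route R4 closes the CONDITIONAL finite-𝕋⁴ rung `BalabanLadder.UV`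
only — NOT the continuum limit, NOT ℝ⁴, NOT OS, NOT the Yang–Mills mass gap, NOT Clay.  No `sorry`, no `instance`, no `notation`, no `axiom`.
Sources: [I] = [Balaban1987RG1] CMP 109 (1987) pp. 259, 262, 264, 266 ((2.9) + the remark), 268 ((2.12)–(2.13)), 293 ((5.10)); [II] =
[Balaban1988RG2Cluster] CMP 116 (1988) Lemma 3 (2.38) p. 20; [III] = [Balaban1988Convergent] CMP 119 (1988) p. 244 (d = 4 clause), p. 246
(g-dependent thresholds `ε_k = g_k p₀(g_k)`), p. 278; J. Dimock, arXiv:1108.1335 §3.2 (coupling-dependent thresholds `p(λ_k)`, «If one of these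
conditions fails then we gain a tiny factor O(e^{−p_k})»), arXiv:1212.5562 Lemma 3.20 («removal of tiny terms»).
-/

noncomputable section

open scoped Matrix.Norms.L2Operator

namespace Summit.QuantumFields.YangMills.Cruxes.EndpointGivenBR13SepCoPH.ThresholdSlide

open Literature.MathematicalPhysics.QuantumFieldTheory.Balaban1983to89
open Literature.MathematicalPhysics.QuantumFieldTheory.Balaban1983to89.FlowStep
open Literature.MathematicalPhysics.QuantumFieldTheory.Balaban1983to89.DagBinding (EndpointExistence)
open Literature.MathematicalPhysics.QuantumFieldTheory.Balaban1983to89.T4Continuum (T4Family)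
open Literature.MathematicalPhysics.QuantumFieldTheory.Balaban1983to89.Node00
open Literature.MathematicalPhysics.QuantumFieldTheory.Balaban1983to89.Beta.OneStepKernelFamily (TbalOf)
open Literature.MathematicalPhysics.QuantumFieldTheory.Balaban1983to89.Beta.OneStepResolventKernel (JetData)
open Summit.QuantumFields.BalabanUV.Gaps

/-! ## §1 The junction — elementary real analysis over a generic history-β (PROVED) -/

/-- `exp(−x) ≤ 1∕x` for `x > 0` (from `x + 1 ≤ exp x`). [folklore] -/
theorem exp_neg_le_one_div {x : ℝ} (hx : 0 < x) : Real.exp (-x) ≤ 1 / x := by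
  rw [Real.exp_neg, one_div]
  exact inv_anti₀ hx ((le_add_of_nonneg_right zero_le_one).trans (Real.add_one_le_exp x))

/-- **THE SLIDING-THRESHOLD JUNCTION** (generic): a history-β `β`, a threshold-indexed family `βe`, a reference sequence `b`.  If (TI) `β` is within
`A·exp(−c(e∕γ′)²)` of `βe e` on every `]0,γ′]`-box, `γ′ ≤ γ`, for every threshold `0 < e ≤ ε`, and (FF) for every `r > 0` SOME threshold `e ≤ ε` has
`βe e` within `r` of `b` on SOME box `]0,γ_e] ⊆ ]0,γ]`, then `β` is within EVERY `s > 0` of `b` on some box `]0,γ₀] ⊆ ]0,γ]`. [folklore] -/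
theorem slide_junction {β : HBeta} {βe : ℝ → HBeta} {b : ℕ → ℝ} {A c ε γ : ℝ} (hA : 0 < A) (hc : 0 < c)
    (hTI : ∀ e : ℝ, 0 < e → e ≤ ε → ∀ γ' : ℝ, 0 < γ' → γ' ≤ γ →
      ∀ (k : ℕ) (p : Fin (k + 1) → ℝ), p ∈ B12Beta.HistBox γ' k → |β k p - βe e k p| ≤ A * Real.exp (-(c * (e / γ') ^ 2)))
    (hFF : ∀ r : ℝ, 0 < r → ∃ e : ℝ, 0 < e ∧ e ≤ ε ∧ ∃ γe : ℝ, 0 < γe ∧ γe ≤ γ ∧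
      ∀ (k : ℕ) (p : Fin (k + 1) → ℝ), p ∈ B12Beta.HistBox γe k → |βe e k p - b k| ≤ r) :
    ∀ s : ℝ, 0 < s → ∃ γ₀ : ℝ, 0 < γ₀ ∧ γ₀ ≤ γ ∧
      ∀ (k : ℕ) (p : Fin (k + 1) → ℝ), p ∈ B12Beta.HistBox γ₀ k → |β k p - b k| ≤ s := by
  intro s hs
  obtain ⟨e, he, heε, γe, hγe, hγeγ, hFFe⟩ := hFF (s / 2) (by positivity)
  set t : ℝ := min 1 (s * c / (2 * A)) with ht
  have ht0 : 0 < t := lt_min one_pos (by positivity)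
  have ht1 : t ≤ 1 := min_le_left _ _
  have htA : t ≤ s * c / (2 * A) := min_le_right _ _
  have hγ₀pos : 0 < min γe (e * t) := lt_min hγe (by positivity)
  have hγ₀γ : min γe (e * t) ≤ γ := (min_le_left _ _).trans hγeγ
  refine ⟨min γe (e * t), hγ₀pos, hγ₀γ, fun k p hp => ?_⟩
  have h1 := hTI e he heε _ hγ₀pos hγ₀γ k p hp
  have hpe : p ∈ B12Beta.HistBox γe k := fun i => ⟨(hp i).1, (hp i).2.trans (min_le_left _ _)⟩
  have h2 := hFFe k p hpe
  -- the Gaussian annulus weight on the shrunk box: `A·exp(−c(e∕γ₀)²) ≤ A·γ₀²∕(c e²) ≤ A·t∕c ≤ s∕2`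
  have hx : 0 < c * (e / min γe (e * t)) ^ 2 := by positivity
  have hexp : Real.exp (-(c * (e / min γe (e * t)) ^ 2)) ≤ 1 / (c * (e / min γe (e * t)) ^ 2) := exp_neg_le_one_div hx
  have hrew : 1 / (c * (e / min γe (e * t)) ^ 2) = (min γe (e * t)) ^ 2 / (c * e ^ 2) := by
    field_simp
  have hsq : (min γe (e * t)) ^ 2 ≤ e ^ 2 * t := by
    have hle : min γe (e * t) ≤ e * t := min_le_right _ _
    calc (min γe (e * t)) ^ 2 ≤ (e * t) ^ 2 := by gcongr
      _ = e ^ 2 * (t * t) := by ring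
      _ ≤ e ^ 2 * (t * 1) := by gcongr
      _ = e ^ 2 * t := by ring
  have h3 : A * Real.exp (-(c * (e / min γe (e * t)) ^ 2)) ≤ s / 2 := by
    calc A * Real.exp (-(c * (e / min γe (e * t)) ^ 2)) ≤ A * ((min γe (e * t)) ^ 2 / (c * e ^ 2)) :=
          mul_le_mul_of_nonneg_left (hexp.trans_eq hrew) hA.le
      _ ≤ A * (e ^ 2 * t / (c * e ^ 2)) := by gcongr
      _ = A * t / c := by field_simp
      _ ≤ A * (s * c / (2 * A)) / c := by gcongr
      _ = s / 2 := by field_simp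
  calc |β k p - b k| ≤ |β k p - βe e k p| + |βe e k p - b k| := abs_sub_le _ _ _
    _ ≤ s / 2 + s / 2 := add_le_add (h1.trans h3) h2
    _ = s := by ring

/-! ## §2 The record's merged β READ AT A THRESHOLD LETTER `e` (no new object: the record's own slots with `chiFixed29 F 2 θ.ν e`) -/

/-- **THE OPEN-LETTER THRESHOLD FAMILY OF THE RECORD**: the merged β of the Stage-13 slots `θ` with the (2.9) fluctuation cut-off read at threshold `e`
(`e = θ.ε₂₉` is the record).  A definition of record re-read, never a claim. [cite: Balaban1987RG1, (2.9) p.266] -/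
def betaAt (F : T4Family) (θ : Node00.Stage13HParams F 2) (e : ℝ) : HBeta :=
  letI := θ.instVβ₁; letI := θ.instVβ₂; letI := θ.instιβ
  betaMerged F (mergedTermFamilyMatT F 2 (TcanOfRecord F 2) (chiFixed29 F 2 θ.ν e) θ.εbg) θ.ρ8 θ.bV

/-- At `e := θ.ε₂₉` the family member IS the record's merged β (the token of v2's stubs), `rfl`. -/
theorem betaAt_record (F : T4Family) (θ : Node00.Stage13HParams F 2) :
    letI := θ.instVβ₁; letI := θ.instVβ₂; letI := θ.instιβ
    betaAt F θ θ.ε₂₉ = betaMerged F (mergedTermFamilyMatT F 2 (TcanOfRecord F 2) (chiFixed29 F 2 θ.ν θ.ε₂₉) θ.εbg) θ.ρ8 θ.bV := rfl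

/-! ## §3 The SHARED stub shapes — VERBATIM from the skeleton of record v2 (plan g79 `K2Skeleton13SepCoPHv2.lean`; attribution: that file's text) -/

/-- rung (D1) at the Stage-13 tuples of `SU(2)` data: the residue of row (D1) with the pin ON THE RECORD's one-loop numbers, channel `(0, 1)`. -/
def D1AtRecord13 : Prop :=
  ∀ (F : T4Family) (θ : Node00.Stage13HParams F 2) (hP : θ.Provisos₁₃SepCoPH F 2), θ.Admissible F 2 →
    letI := θ.instVβ₁; letI := θ.instVβ₂; letI := θ.instιβ
    ∃ (Lc : ℕ) (_ : NeZero Lc) (Js : ℕ → JetData 3 Lc) (Nc : ℝ),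
      (∀ j, beta0OfMerged (betaMerged F (mergedTermFamilyMatT F 2 (TcanOfRecord F 2) (chiFixed29 F 2 θ.ν θ.ε₂₉) θ.εbg) θ.ρ8 θ.bV) θ.v₀ j =
          B12Beta.secondMoment (TbalOf Lc Js j) 0 1) ∧
      D1Residue.Residue Lc Js Nc 0 1


/-- STUB SHAPE S0 «the flat-corner guard» (shared exposure with the registered `D4AtSlopeOfD1Record13`, an4 g148 census): every (D1) datum pinned on the
record's one-loop numbers has POSITIVE slope `stepBal Nc Lc` — asymptotic freedom's sign, row (D1)'s business (a degenerate witness `Nc = 0` kills this line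
exactly as it kills the registered one, `historyFree_of_d4Stub_flatDatum`). -/
def SlopePosOfD1Record13 : Prop :=
  ∀ (F : T4Family) (θ : Node00.Stage13HParams F 2) (hP : θ.Provisos₁₃SepCoPH F 2), θ.Admissible F 2 →
    letI := θ.instVβ₁; letI := θ.instVβ₂; letI := θ.instιβ
    ∀ (Lc : ℕ) (_ : NeZero Lc) (Js : ℕ → JetData 3 Lc) (Nc : ℝ),
      (∀ j, beta0OfMerged (betaMerged F (mergedTermFamilyMatT F 2 (TcanOfRecord F 2) (chiFixed29 F 2 θ.ν θ.ε₂₉) θ.εbg) θ.ρ8 θ.bV) θ.v₀ j =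
          B12Beta.secondMoment (TbalOf Lc Js j) 0 1) →
      D1Residue.Residue Lc Js Nc 0 1 → 0 < B12Normalization.stepBal Nc Lc

/-- STUB SHAPE S3 «box continuity of the record's β» (the (C) binder; the registered line takes it from the chain's leaves `CPt`, the T4 spine from
`HistLipschitz` via `T4BetaStationary.betaContH_of_histLipschitz`): `BetaContH θ.γ` of the record's β, scale by scale (no uniformity). -/
def ContRecord13 : Prop :=
  ∀ (F : T4Family) (θ : Node00.Stage13HParams F 2) (hP : θ.Provisos₁₃SepCoPH F 2), θ.Admissible F 2 →
    letI := θ.instVβ₁; letI := θ.instVβ₂; letI := θ.instιβ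
    BetaContH θ.γ
      (betaOfMerged (betaMerged F (mergedTermFamilyMatT F 2 (TcanOfRecord F 2) (chiFixed29 F 2 θ.ν θ.ε₂₉) θ.εbg) θ.ρ8 θ.bV)
        (beta0OfMerged (betaMerged F (mergedTermFamilyMatT F 2 (TcanOfRecord F 2) (chiFixed29 F 2 θ.ν θ.ε₂₉) θ.εbg) θ.ρ8 θ.bV) θ.v₀) θ.γ)


/-- **(D1)-SIDE SHAPE OF RECORD `D1AtRecord13Pos` — VERBATIM from the REGISTERED skeleton v3** (plan g80 `K2Skeleton13SepCoPHv3.lean` :491, line 2's registered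
stub `stub_d1ResiduePos13`; b2b-an4 g151's free cut = `D1AtRecord13 ∧ SlopePosOfD1Record13`, `BalabanUVNodesK2Line2SlopeGuardPrice.d1Pos13_iff_d1_and_slopePos13`).
Attribution: that file's text.  A hypothesis SHAPE, never a fact. -/
def D1AtRecord13Pos : Prop :=
  ∀ (F : T4Family) (θ : Node00.Stage13HParams F 2) (hP : θ.Provisos₁₃SepCoPH F 2), θ.Admissible F 2 →
    letI := θ.instVβ₁; letI := θ.instVβ₂; letI := θ.instιβ
    ∃ (Lc : ℕ) (_ : NeZero Lc) (Js : ℕ → JetData 3 Lc) (Nc : ℝ),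
      0 < B12Normalization.stepBal Nc Lc ∧
      (∀ j, beta0OfMerged (betaMerged F (mergedTermFamilyMatT F 2 (TcanOfRecord F 2) (chiFixed29 F 2 θ.ν θ.ε₂₉) θ.εbg) θ.ρ8 θ.bV) θ.v₀ j =
          B12Beta.secondMoment (TbalOf Lc Js j) 0 1) ∧
      D1Residue.Residue Lc Js Nc 0 1


/-! ## §4 The two NEW stub shapes of the line -/

/-- **(TI) k-UNIFORM THRESHOLD INSENSITIVITY OF THE RECORD's MERGED β** (NEW; NOT PRINTED as a difference estimate; size XL): at every admissible Stage-13 tuple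
there are `A, c > 0` such that for every smaller threshold `0 < e ≤ θ.ε₂₉` and every box `]0,γ′] ⊆ ]0,θ.γ]`, on `]0,γ′]`-histories of every length,
`|β_θ − β_e| ≤ A·exp(−c·(e∕γ′)²)` — the Gaussian weight of the fluctuation annulus `e ≤ |B′(b)| < θ.ε₂₉` at the LARGEST coupling of the history (box size in the
exponent, not the last coupling: a history with large early couplings and a tiny last one differs at early scales), transported k-uniformly by the fading memory of
the difference flow.  Printed locus of the degree of freedom: [Balaban1987RG1] p. 266 after (2.9).  A hypothesis SHAPE, never a fact. -/
def ThresholdInsensitive13 : Prop :=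
  ∀ (F : T4Family) (θ : Node00.Stage13HParams F 2) (hP : θ.Provisos₁₃SepCoPH F 2), θ.Admissible F 2 →
    ∃ A c : ℝ, 0 < A ∧ 0 < c ∧ ∀ e : ℝ, 0 < e → e ≤ θ.ε₂₉ → ∀ γ' : ℝ, 0 < γ' → γ' ≤ θ.γ →
      ∀ (k : ℕ) (p : Fin (k + 1) → ℝ), p ∈ B12Beta.HistBox γ' k →
        |betaAt F θ θ.ε₂₉ k p - betaAt F θ e k p| ≤ A * Real.exp (-(c * (e / γ') ^ 2))

/-- **(FF) PRINT's ε₁-FROZEN REMAINDER BOUND READ ALONG THE OPEN-LETTER FAMILY, minimal form** (NEW SHAPE of rows (D4) ∧ B4's open-letter product; size L–XL):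
for every (D1) datum `(Lc, Js, Nc)` pinned on the record and every `r > 0`, SOME threshold `0 < e ≤ θ.ε₂₉` and SOME box `]0,γ_e] ⊆ ]0,θ.γ]` on which the
threshold-`e` member is within `r` of the datum's one-loop numbers `secondMoment (TbalOf Lc Js k) 0 1`, at every scale.  Printed chain: [Balaban1988RG2Cluster]
Lemma 3 (2.38) p. 20 (`r = ε₁·K`) → [Balaban1987RG1] (5.10) p. 293 → (1.22) p. 264, with Thm 3's «γ depends on all other constants» as the member's window;
the k-uniform (D4) estimate is the cell's located gap (GAPS G-b12-2).  NO g-resolution, NO window rate.  A hypothesis SHAPE, never a fact. -/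
def FrozenFamilyOfD1Record13 : Prop :=
  ∀ (F : T4Family) (θ : Node00.Stage13HParams F 2) (hP : θ.Provisos₁₃SepCoPH F 2), θ.Admissible F 2 →
    letI := θ.instVβ₁; letI := θ.instVβ₂; letI := θ.instιβ
    ∀ (Lc : ℕ) (_ : NeZero Lc) (Js : ℕ → JetData 3 Lc) (Nc : ℝ),
      (∀ j, beta0OfMerged (betaMerged F (mergedTermFamilyMatT F 2 (TcanOfRecord F 2) (chiFixed29 F 2 θ.ν θ.ε₂₉) θ.εbg) θ.ρ8 θ.bV) θ.v₀ j =
          B12Beta.secondMoment (TbalOf Lc Js j) 0 1) →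
      D1Residue.Residue Lc Js Nc 0 1 →
      ∀ r : ℝ, 0 < r → ∃ e : ℝ, 0 < e ∧ e ≤ θ.ε₂₉ ∧ ∃ γe : ℝ, 0 < γe ∧ γe ≤ θ.γ ∧
        ∀ (k : ℕ) (p : Fin (k + 1) → ℝ), p ∈ B12Beta.HistBox γe k →
          |betaAt F θ e k p - B12Beta.secondMoment (TbalOf Lc Js k) 0 1| ≤ r

/-! ## §5 The composition — K2⁷ BY NAME from the five stub shapes (kernel, no sorry) -/

/-- **(D1) → S0 → (TI) → (FF) → (C) ⟹ the (D4) constant-remainder smallness of the record's DEFINITIONAL split AT THE RECORD's THRESHOLD at the (D1) slope**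
(the junction of §1 at `s := stepBal Nc Lc`; the split's remainder on the box IS `β_merged − β⁰`, `Node00.oneLoopSplit_betaOfMerged`). [folklore] -/
theorem remainderConst13_of_slide (h₁ : D1AtRecord13) (h₀ : SlopePosOfD1Record13) (hT : ThresholdInsensitive13) (hF : FrozenFamilyOfD1Record13)
    (F : T4Family) (θ : Node00.Stage13HParams F 2) (hP : θ.Provisos₁₃SepCoPH F 2) (hθ : θ.Admissible F 2) :
    letI := θ.instVβ₁; letI := θ.instVβ₂; letI := θ.instιβ
    ∃ (Lc : ℕ) (_ : NeZero Lc) (Js : ℕ → JetData 3 Lc) (Nc : ℝ),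
      (∀ j, beta0OfMerged (betaMerged F (mergedTermFamilyMatT F 2 (TcanOfRecord F 2) (chiFixed29 F 2 θ.ν θ.ε₂₉) θ.εbg) θ.ρ8 θ.bV) θ.v₀ j =
          B12Beta.secondMoment (TbalOf Lc Js j) 0 1) ∧
      D1Residue.Residue Lc Js Nc 0 1 ∧
      ∃ γ₀ : ℝ, 0 < γ₀ ∧ γ₀ ≤ θ.γ ∧
        ∀ (k : ℕ) (p : Fin (k + 1) → ℝ), p ∈ B12Beta.HistBox γ₀ k →
          |(oneLoopSplit_betaOfMerged (betaMerged F (mergedTermFamilyMatT F 2 (TcanOfRecord F 2) (chiFixed29 F 2 θ.ν θ.ε₂₉) θ.εbg) θ.ρ8 θ.bV)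
              (beta0OfMerged (betaMerged F (mergedTermFamilyMatT F 2 (TcanOfRecord F 2) (chiFixed29 F 2 θ.ν θ.ε₂₉) θ.εbg) θ.ρ8 θ.bV) θ.v₀) θ.γ).β1 k p|
            ≤ B12Normalization.stepBal Nc Lc := by
  letI := θ.instVβ₁; letI := θ.instVβ₂; letI := θ.instιβ
  obtain ⟨Lc, _, Js, Nc, hβ, h1⟩ := h₁ F θ hP hθ
  have hslope : 0 < B12Normalization.stepBal Nc Lc := h₀ F θ hP hθ Lc inferInstance Js Nc hβ h1
  obtain ⟨A, c, hA, hc, hTI⟩ := hT F θ hP hθ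
  have hFF := hF F θ hP hθ Lc inferInstance Js Nc hβ h1
  obtain ⟨γ₀, hγ₀, hγ₀le, hsmall⟩ :=
    slide_junction (β := betaAt F θ θ.ε₂₉) (βe := betaAt F θ) (b := fun k => B12Beta.secondMoment (TbalOf Lc Js k) 0 1)
      hA hc hTI hFF _ hslope
  refine ⟨Lc, inferInstance, Js, Nc, hβ, h1, γ₀, hγ₀, hγ₀le, fun k p hp => ?_⟩
  have hpbox : p ∈ Box θ.γ k := mem_box.mpr fun i => ⟨(hp i).1, (hp i).2.trans hγ₀le⟩
  show |(Box θ.γ k).indicator (fun w => betaMerged F (mergedTermFamilyMatT F 2 (TcanOfRecord F 2) (chiFixed29 F 2 θ.ν θ.ε₂₉) θ.εbg) θ.ρ8 θ.bV k w -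
      beta0OfMerged (betaMerged F (mergedTermFamilyMatT F 2 (TcanOfRecord F 2) (chiFixed29 F 2 θ.ν θ.ε₂₉) θ.εbg) θ.ρ8 θ.bV) θ.v₀ k) p| ≤ _
  rw [Set.indicator_of_mem hpbox, hβ k]
  exact hsmall k p hp

/-- **THE LINE's COMPOSITION (kernel, no sorry): `D1AtRecord13 → SlopePosOfD1Record13 → ThresholdInsensitive13 → FrozenFamilyOfD1Record13 → ContRecord13 → K2⁷`**,
the crux decl BY NAME, through `Gaps.D1Residue.endpointExistence_of_residue` at the datum of record (forward generation = the datum's field `fwd`; the datum's β IS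
`betaOfMerged … θ.γ` definitionally; the crux's unity, (B) and window hypotheses are unused on this β-side road, as on lines 1–2). -/
theorem EndpointGivenBR13SepCoPH_of_thresholdSlide (h₁ : D1AtRecord13) (h₀ : SlopePosOfD1Record13) (hT : ThresholdInsensitive13)
    (hF : FrozenFamilyOfD1Record13) (h₄ : ContRecord13) :
    Summit.QuantumFields.YangMills.Theses.BalabanUVNodes.EndpointGivenBR13SepCoPH := by
  intro F θ hP _hU hθ _hB _hwin
  letI := θ.instVβ₁; letI := θ.instVβ₂; letI := θ.instιβ
  obtain ⟨Lc, _, Js, Nc, hβ, h1, γ₀, hγ₀, hγ₀le, hrem⟩ := remainderConst13_of_slide h₁ h₀ hT hF F θ hP hθ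
  have hcont := h₄ F θ hP hθ
  exact D1Residue.endpointExistence_of_residue (Node00.datumOfRecord₁₃SepCoPH F 2 θ hP).fwd
    (oneLoopSplit_betaOfMerged _ _ _) Js (fun j => hβ j) h1 hγ₀ hrem le_rfl
    (fun k => (hcont k).mono (box_mono hγ₀le k))

/-- **THE LINE's REGISTRATION FORM against v3 (kernel, no sorry): `D1AtRecord13Pos → ThresholdInsensitive13 → FrozenFamilyOfD1Record13 → ContRecord13 → K2⁷`** —
two binders are REGISTERED v3 stub texts (`stub_d1ResiduePos13`, `stub_cont13`), two are the line's NEW shapes (TI), (FF); the crux decl BY NAME. [folklore] -/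
theorem EndpointGivenBR13SepCoPH_of_thresholdSlideP (h : D1AtRecord13Pos) (hT : ThresholdInsensitive13)
    (hF : FrozenFamilyOfD1Record13) (h₄ : ContRecord13) :
    Summit.QuantumFields.YangMills.Theses.BalabanUVNodes.EndpointGivenBR13SepCoPH :=
  EndpointGivenBR13SepCoPH_of_thresholdSlide
    (Summit.QuantumFields.YangMills.Theorems.BalabanUVNodesK2Line2SlopeGuardPrice.d1Pos13_iff_d1_and_slopePos13.1 h).1
    (Summit.QuantumFields.YangMills.Theorems.BalabanUVNodesK2Line2SlopeGuardPrice.slopePos13_of_d1Pos13 h) hT hF h₄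

/-! ## §6 EDITION 2 — the NAMED-NUMBERS, SPLIT-FREE registration form (the critics' standing standard on this crux: CRIT-1 g2 `RemAtN` — κ AFTER θ and the
chart constant `θ.cβ` CARRIED; CRIT-2 g2 `Theorems/EndpointGivenBR13SepCoPH/Negative/Anchor13FalseOfTwoBaseHistories` — no per-tuple anchor of the β of record at its
OWN zero-history (`v₀`-`limUnder`) values).  The threshold family is read through `betaMerged` (v₀-free); the reference numbers are the NAMED `θ.cβ · beta0OfJs F κ k`
(DEF-1 p588621); the END is an4's split-free constant-form `endpointExistence_of_drift_constRemainder` (p590583).  Under `TwoBaseHistories` both tuples anchor their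
common β at the SAME named numbers — nothing to refute; under `TwoNormalisations` the numbers rescale with `θ.cβ` — nothing to refute. -/

section NamedNumbers

open Summit.QuantumFields.YangMills.Theorems.BalabanUVNodesK2JsOfRecord (StepColourData beta0OfJs)
open Summit.QuantumFields.YangMills.Theorems.BalabanUVNodesK2Line1PrimeRemainderPrice (endpointExistence_of_drift_constRemainder)
open Literature.MathematicalPhysics.QuantumFieldTheory.Balaban1983to89.Beta.Drift (OneLoopDrift)

/-- rescaling a drift (CRIT-1 g2's `oneLoopDrift_const_mul`, re-proved here so that no mutable crux workfile is imported). [folklore] -/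
theorem oneLoopDrift_const_mul' {b : ℕ → ℝ} {s A : ℝ} (h : OneLoopDrift s A b) (c : ℝ) :
    OneLoopDrift (c * s) (|c| * A) (fun k => c * b k) := by
  intro k
  rw [← Finset.mul_sum, mul_assoc, ← mul_sub, abs_mul]
  exact mul_le_mul_of_nonneg_left (h k) (abs_nonneg c)

/-- **THE EVERY-SLOPE SHADOWING PACKAGE BY NAMED NUMBERS `ShadowN F κ θ hP`** (what (TI) ∘ (FFᴺ) OUTPUTS at the record): for every `s > 0` some box
`]0,γ₀] ⊆ ]0,θ.γ]` on which the β of record is within `s` of `θ.cβ · beta0OfJs F κ k`, at every scale.  Constant form, every slope, split-free, normalisation carried.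
A hypothesis∕conclusion SHAPE. -/
def ShadowN (F : T4Family) (κ : StepColourData) (θ : Node00.Stage13HParams F 2) (hP : θ.Provisos₁₃SepCoPH F 2) : Prop :=
  ∀ s : ℝ, 0 < s → ∃ γ₀ : ℝ, 0 < γ₀ ∧ γ₀ ≤ θ.γ ∧
    ∀ (k : ℕ) (p : Fin (k + 1) → ℝ), p ∈ B12Beta.HistBox γ₀ k →
      |(Node00.datumOfRecord₁₃SepCoPH F 2 θ hP).βfun k p - θ.cβ * beta0OfJs F κ k| ≤ s

/-- **(FFᴺ) PRINT's ε₁-FROZEN REMAINDER BOUND ALONG THE OPEN-LETTER FAMILY, NAMED-NUMBERS FORM** (κ AFTER θ; `θ.cβ` carried; minimal: ∀ r ∃ e ∃ γ_e; size L–XL):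
at every admissible tuple SOME colour datum κ such that for every `r > 0` SOME threshold `0 < e ≤ θ.ε₂₉` member is within `r` of `θ.cβ · beta0OfJs F κ k` on SOME box
`]0,γ_e] ⊆ ]0,θ.γ]`, at every scale.  (κ is no free knob: with (TI) the package anchors the record's β, and anchors determine their numbers, an4 `eq_of_anchors`.)
[cite: Balaban1988RG2Cluster, Lemma 3 (2.38) p.20; Balaban1987RG1, (5.10) p.293, (1.22) p.264, (2.9) p.266] -/
def FrozenFamilyNamedJets13 : Prop :=
  ∀ (F : T4Family) (θ : Node00.Stage13HParams F 2) (hP : θ.Provisos₁₃SepCoPH F 2), θ.Admissible F 2 →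
    ∃ κ : StepColourData, ∀ r : ℝ, 0 < r → ∃ e : ℝ, 0 < e ∧ e ≤ θ.ε₂₉ ∧ ∃ γe : ℝ, 0 < γe ∧ γe ≤ θ.γ ∧
      ∀ (k : ℕ) (p : Fin (k + 1) → ℝ), p ∈ B12Beta.HistBox γe k →
        |betaAt F θ e k p - θ.cβ * beta0OfJs F κ k| ≤ r

/-- **(D1ᴺ) ROW (D1) AT THE RECORD CARRIED BY THE NAMED JETS, keyed on the every-slope package** (= v3's `D1AtShadowingJets` ∕ CRIT-1 g2's `D1AtNShadowingJets` with the
hypothesis `RemAt`∕`RemAtN` replaced by `ShadowN`; USE FORM: row (D1) at EVERY colour datum at `Lc := F.L` discharges it, hypothesis unused; size L).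
[cite: Balaban1987RG1, (1.3) p.260 with (2.12)–(2.13) p.268] -/
def D1AtNEverySlopeJets : Prop :=
  ∀ (F : T4Family) (κ : StepColourData) (θ : Node00.Stage13HParams F 2) (hP : θ.Provisos₁₃SepCoPH F 2), θ.Admissible F 2 →
    ShadowN F κ θ hP → ∃ A : ℝ, OneLoopDrift (B12Normalization.stepBal 2 F.L) A (beta0OfJs F κ)

/-- **(U) AT THE RECORD** — the printed uniform upper bound of the β-functions on the record's box ([I] Thm 3 p. 264 «β_j uniformly bounded»; the `BetaUpperH` conjunct
of v3's `RemAt` ∕ CRIT-1's `RemAtN`), per tuple; size M (a (B)∕Thm-3 item). [cite: Balaban1987RG1, Thm 3 p.264] -/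
def UpperRecord13 : Prop :=
  ∀ (F : T4Family) (θ : Node00.Stage13HParams F 2) (hP : θ.Provisos₁₃SepCoPH F 2), θ.Admissible F 2 →
    ∃ β' : ℝ, 0 ≤ β' ∧ BetaUpperH β' θ.γ (Node00.datumOfRecord₁₃SepCoPH F 2 θ hP).βfun

/-- USE FORM of (D1ᴺ): a (D1) theorem «row D1 at EVERY colour datum» discharges it. [folklore] -/
theorem d1AtNEverySlopeJets_of_d1Drift_all
    (h : ∀ (F : T4Family) (κ : StepColourData), ∃ A : ℝ, OneLoopDrift (B12Normalization.stepBal 2 F.L) A (beta0OfJs F κ)) :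
    D1AtNEverySlopeJets := fun F κ _θ _hP _hθ _hS => h F κ

/-- **(TI) ∘ (FFᴺ) ⟹ the every-slope shadowing package at the produced κ** (the junction of §1; on the box the β of record IS the merged β, `betaOfMerged_of_mem`). [folklore] -/
theorem shadowN_of_slide (hT : ThresholdInsensitive13) (hF : FrozenFamilyNamedJets13)
    (F : T4Family) (θ : Node00.Stage13HParams F 2) (hP : θ.Provisos₁₃SepCoPH F 2) (hθ : θ.Admissible F 2) :
    ∃ κ : StepColourData, ShadowN F κ θ hP := by
  obtain ⟨A, c, hA, hc, hTI⟩ := hT F θ hP hθ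
  obtain ⟨κ, hFF⟩ := hF F θ hP hθ
  refine ⟨κ, fun s hs => ?_⟩
  obtain ⟨γ₀, hγ₀, hγ₀le, hsmall⟩ :=
    slide_junction (β := betaAt F θ θ.ε₂₉) (βe := betaAt F θ) (b := fun k => θ.cβ * beta0OfJs F κ k) hA hc hTI hFF s hs
  refine ⟨γ₀, hγ₀, hγ₀le, fun k p hp => ?_⟩
  have hpbox : p ∈ Box θ.γ k := mem_box.mpr fun i => ⟨(hp i).1, (hp i).2.trans hγ₀le⟩
  letI := θ.instVβ₁; letI := θ.instVβ₂; letI := θ.instιβ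
  have e : (Node00.datumOfRecord₁₃SepCoPH F 2 θ hP).βfun k p = betaAt F θ θ.ε₂₉ k p :=
    Node00.betaOfMerged_of_mem _ _ _ hpbox
  rw [e]
  exact hsmall k p hp

/-- **EDITION 2's COMPOSITION (kernel, no sorry): `D1AtNEverySlopeJets → ThresholdInsensitive13 → FrozenFamilyNamedJets13 → ContRecord13 → UpperRecord13 → K2⁷`**, the crux
decl BY NAME, through an4's split-free `endpointExistence_of_drift_constRemainder` at the datum's `fwd` with the slope `θ.cβ · stepBal 2 F.L` (`0 < θ.cβ` from Stage-9
admissibility, `0 < stepBal 2 F.L` from `1 < F.L`) and the seam `s := θ.cβ · stepBal 2 F.L` itself. [folklore] -/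
theorem EndpointGivenBR13SepCoPH_of_thresholdSlideN (h₁ : D1AtNEverySlopeJets) (hT : ThresholdInsensitive13) (hF : FrozenFamilyNamedJets13)
    (h₄ : ContRecord13) (h₅ : UpperRecord13) :
    Summit.QuantumFields.YangMills.Theses.BalabanUVNodes.EndpointGivenBR13SepCoPH := by
  intro F θ hP _hU hθ _hB _hwin
  obtain ⟨κ, hS⟩ := shadowN_of_slide hT hF F θ hP hθ
  obtain ⟨A, hdrift⟩ := h₁ F κ θ hP hθ hS
  have hcβ : 0 < θ.cβ := hθ.toStage9.chart.1
  have hstep : 0 < B12Normalization.stepBal 2 (F.L : ℝ) := B12Normalization.stepBal_pos (by norm_num) (by exact_mod_cast F.hL.2)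
  have hs : 0 < θ.cβ * B12Normalization.stepBal 2 F.L := mul_pos hcβ hstep
  obtain ⟨γ₀, hγ₀, hγ₀le, hrem⟩ := hS _ hs
  obtain ⟨β', hβ', hup⟩ := h₅ F θ hP hθ
  have hcont := h₄ F θ hP hθ
  have hdrift' := oneLoopDrift_const_mul' hdrift θ.cβ
  exact endpointExistence_of_drift_constRemainder (Node00.datumOfRecord₁₃SepCoPH F 2 θ hP).fwd hγ₀ hdrift' hrem le_rfl hβ'
    (fun k => (hcont k).mono (box_mono hγ₀le k)) (fun k v hv => hup k v (box_mono hγ₀le k hv))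

end NamedNumbers

/-! ## §7 THE MINIMAL (RATE-FREE) FORM OF (TI) — what the line actually NEEDS from the comparison: k-UNIFORM CONTINUITY OF THE THRESHOLD FAMILY AT THE
ZERO-COUPLING CORNER, MEMBER BY MEMBER (no rate, no uniformity in the member `e`).  The Gaussian-annulus form `A·exp(−c(e∕γ′)²)` of §4 is the EXPECTED truth
and implies it (`thresholdCorner_of_insensitive`); so does any polynomial source `A·(γ′∕e)^m`, `m ≥ 1` (e.g. the `g_j^{κ₀}` sources of [III] (2.31) p. 260,
should the comparison at out-of-regime tuples be of C14 grade).  The composition `…_of_thresholdSlideNmin` concludes K2⁷ BY NAME from the minimal form. -/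

section MinimalForm

open Summit.QuantumFields.YangMills.Theorems.BalabanUVNodesK2JsOfRecord (StepColourData beta0OfJs)
open Summit.QuantumFields.YangMills.Theorems.BalabanUVNodesK2Line1PrimeRemainderPrice (endpointExistence_of_drift_constRemainder)
open Literature.MathematicalPhysics.QuantumFieldTheory.Balaban1983to89.Beta.Drift (OneLoopDrift)

/-- **THE RATE-FREE JUNCTION**: if for every member `0 < e ≤ ε` and every `η > 0` the history-β `β` is within `η` of `βe e` on all sufficiently small boxes
(`γ′ ≤ δ(e,η)`, `γ′ ≤ γ`), uniformly in the scale, and (FF) holds, then `β` is within every `s > 0` of `b` on some box `]0,γ₀] ⊆ ]0,γ]`. [folklore] -/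
theorem slide_junction_min {β : HBeta} {βe : ℝ → HBeta} {b : ℕ → ℝ} {ε γ : ℝ}
    (hTI : ∀ e : ℝ, 0 < e → e ≤ ε → ∀ η : ℝ, 0 < η → ∃ δ : ℝ, 0 < δ ∧ ∀ γ' : ℝ, 0 < γ' → γ' ≤ δ → γ' ≤ γ →
      ∀ (k : ℕ) (p : Fin (k + 1) → ℝ), p ∈ B12Beta.HistBox γ' k → |β k p - βe e k p| ≤ η)
    (hFF : ∀ r : ℝ, 0 < r → ∃ e : ℝ, 0 < e ∧ e ≤ ε ∧ ∃ γe : ℝ, 0 < γe ∧ γe ≤ γ ∧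
      ∀ (k : ℕ) (p : Fin (k + 1) → ℝ), p ∈ B12Beta.HistBox γe k → |βe e k p - b k| ≤ r) :
    ∀ s : ℝ, 0 < s → ∃ γ₀ : ℝ, 0 < γ₀ ∧ γ₀ ≤ γ ∧
      ∀ (k : ℕ) (p : Fin (k + 1) → ℝ), p ∈ B12Beta.HistBox γ₀ k → |β k p - b k| ≤ s := by
  intro s hs
  obtain ⟨e, he, heε, γe, hγe, hγeγ, hFFe⟩ := hFF (s / 2) (by positivity)
  obtain ⟨δ, hδ, hTIe⟩ := hTI e he heε (s / 2) (by positivity)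
  have hγ₀pos : 0 < min γe δ := lt_min hγe hδ
  have hγ₀γ : min γe δ ≤ γ := (min_le_left _ _).trans hγeγ
  refine ⟨min γe δ, hγ₀pos, hγ₀γ, fun k p hp => ?_⟩
  have h1 := hTIe _ hγ₀pos (min_le_right _ _) hγ₀γ k p hp
  have hpe : p ∈ B12Beta.HistBox γe k := fun i => ⟨(hp i).1, (hp i).2.trans (min_le_left _ _)⟩
  have h2 := hFFe k p hpe
  calc |β k p - b k| ≤ |β k p - βe e k p| + |βe e k p - b k| := abs_sub_le _ _ _
    _ ≤ s / 2 + s / 2 := add_le_add h1 h2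
    _ = s := by ring

/-- **(TI-min) k-UNIFORM THRESHOLD-CONTINUITY AT THE ZERO-COUPLING CORNER, MEMBER BY MEMBER** — the minimal registration form of the comparison: for every member
`0 < e ≤ θ.ε₂₉` and every `η > 0` there is `δ > 0` such that on every `]0,γ′]`-box with `γ′ ≤ δ`, `γ′ ≤ θ.γ`, the record's β is within `η` of the member's,
AT EVERY SCALE (the k-uniformity is the whole content; no rate, no uniformity in `e`).  NOT PRINTED; size XL; ownerless. [conjecture] -/
def ThresholdCorner13 : Prop :=
  ∀ (F : T4Family) (θ : Node00.Stage13HParams F 2) (hP : θ.Provisos₁₃SepCoPH F 2), θ.Admissible F 2 →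
    ∀ e : ℝ, 0 < e → e ≤ θ.ε₂₉ → ∀ η : ℝ, 0 < η → ∃ δ : ℝ, 0 < δ ∧ ∀ γ' : ℝ, 0 < γ' → γ' ≤ δ → γ' ≤ θ.γ →
      ∀ (k : ℕ) (p : Fin (k + 1) → ℝ), p ∈ B12Beta.HistBox γ' k → |betaAt F θ θ.ε₂₉ k p - betaAt F θ e k p| ≤ η

/-- the Gaussian-annulus form (TI) implies the minimal form (TI-min): `A·exp(−c(e∕γ′)²) ≤ A·γ′²∕(c e²) ≤ η` once `γ′ ≤ e·min(1, ηc∕A)`. [folklore] -/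
theorem thresholdCorner_of_insensitive (h : ThresholdInsensitive13) : ThresholdCorner13 := by
  intro F θ hP hθ e he heε η hη
  obtain ⟨A, c, hA, hc, hTI⟩ := h F θ hP hθ
  set t : ℝ := min 1 (η * c / A) with ht
  have ht0 : 0 < t := lt_min one_pos (by positivity)
  have ht1 : t ≤ 1 := min_le_left _ _
  have htA : t ≤ η * c / A := min_le_right _ _
  refine ⟨e * t, by positivity, fun γ' hγ' hγ'δ hγ'γ k p hp => ?_⟩
  have h1 := hTI e he heε γ' hγ' hγ'γ k p hp
  have hx : 0 < c * (e / γ') ^ 2 := by positivity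
  have hexp : Real.exp (-(c * (e / γ') ^ 2)) ≤ 1 / (c * (e / γ') ^ 2) := exp_neg_le_one_div hx
  have hrew : 1 / (c * (e / γ') ^ 2) = γ' ^ 2 / (c * e ^ 2) := by
    field_simp
  have hsq : γ' ^ 2 ≤ e ^ 2 * t := by
    calc γ' ^ 2 ≤ (e * t) ^ 2 := by gcongr
      _ = e ^ 2 * (t * t) := by ring
      _ ≤ e ^ 2 * (t * 1) := by gcongr
      _ = e ^ 2 * t := by ring
  have h3 : A * Real.exp (-(c * (e / γ') ^ 2)) ≤ η := by
    calc A * Real.exp (-(c * (e / γ') ^ 2)) ≤ A * (γ' ^ 2 / (c * e ^ 2)) :=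
          mul_le_mul_of_nonneg_left (hexp.trans_eq hrew) hA.le
      _ ≤ A * (e ^ 2 * t / (c * e ^ 2)) := by gcongr
      _ = A * t / c := by field_simp
      _ ≤ A * (η * c / A) / c := by gcongr
      _ = η := by field_simp
  exact h1.trans h3

/-- **(TI-poly)**: a polynomial source `A·(γ′∕e)` (any power ≥ 1 is weaker still on small boxes) also implies (TI-min) — so a C14-grade comparison with `g^{κ₀}` sources would do.
[folklore] -/
theorem thresholdCorner_of_linearSource
    (h : ∀ (F : T4Family) (θ : Node00.Stage13HParams F 2) (hP : θ.Provisos₁₃SepCoPH F 2), θ.Admissible F 2 →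
      ∃ A : ℝ, 0 < A ∧ ∀ e : ℝ, 0 < e → e ≤ θ.ε₂₉ → ∀ γ' : ℝ, 0 < γ' → γ' ≤ θ.γ →
        ∀ (k : ℕ) (p : Fin (k + 1) → ℝ), p ∈ B12Beta.HistBox γ' k → |betaAt F θ θ.ε₂₉ k p - betaAt F θ e k p| ≤ A * (γ' / e)) :
    ThresholdCorner13 := by
  intro F θ hP hθ e he heε η hη
  obtain ⟨A, hA, hTI⟩ := h F θ hP hθ
  refine ⟨e * (η / A), by positivity, fun γ' hγ' hγ'δ hγ'γ k p hp => (hTI e he heε γ' hγ' hγ'γ k p hp).trans ?_⟩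
  calc A * (γ' / e) ≤ A * (e * (η / A) / e) := by gcongr
    _ = η := by field_simp

/-- (TI-min) ∘ (FFᴺ) ⟹ the every-slope shadowing package by named numbers. [folklore] -/
theorem shadowN_of_corner (hT : ThresholdCorner13) (hF : FrozenFamilyNamedJets13)
    (F : T4Family) (θ : Node00.Stage13HParams F 2) (hP : θ.Provisos₁₃SepCoPH F 2) (hθ : θ.Admissible F 2) :
    ∃ κ : StepColourData, ShadowN F κ θ hP := by
  obtain ⟨κ, hFF⟩ := hF F θ hP hθ
  refine ⟨κ, fun s hs => ?_⟩
  obtain ⟨γ₀, hγ₀, hγ₀le, hsmall⟩ :=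
    slide_junction_min (β := betaAt F θ θ.ε₂₉) (βe := betaAt F θ) (b := fun k => θ.cβ * beta0OfJs F κ k) (hT F θ hP hθ) hFF s hs
  refine ⟨γ₀, hγ₀, hγ₀le, fun k p hp => ?_⟩
  have hpbox : p ∈ Box θ.γ k := mem_box.mpr fun i => ⟨(hp i).1, (hp i).2.trans hγ₀le⟩
  letI := θ.instVβ₁; letI := θ.instVβ₂; letI := θ.instιβ
  have e : (Node00.datumOfRecord₁₃SepCoPH F 2 θ hP).βfun k p = betaAt F θ θ.ε₂₉ k p :=
    Node00.betaOfMerged_of_mem _ _ _ hpbox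
  rw [e]
  exact hsmall k p hp

/-- **THE MINIMAL-FORM COMPOSITION (kernel, no sorry): `D1AtNEverySlopeJets → ThresholdCorner13 → FrozenFamilyNamedJets13 → ContRecord13 → UpperRecord13 → K2⁷`**,
the crux decl BY NAME (the exponential-form composition `…_of_thresholdSlideN` of §6 factors through it via `thresholdCorner_of_insensitive`). [folklore] -/
theorem EndpointGivenBR13SepCoPH_of_thresholdSlideNmin (h₁ : D1AtNEverySlopeJets) (hT : ThresholdCorner13) (hF : FrozenFamilyNamedJets13)
    (h₄ : ContRecord13) (h₅ : UpperRecord13) :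
    Summit.QuantumFields.YangMills.Theses.BalabanUVNodes.EndpointGivenBR13SepCoPH := by
  intro F θ hP _hU hθ _hB _hwin
  obtain ⟨κ, hS⟩ := shadowN_of_corner hT hF F θ hP hθ
  obtain ⟨A, hdrift⟩ := h₁ F κ θ hP hθ hS
  have hcβ : 0 < θ.cβ := hθ.toStage9.chart.1
  have hstep : 0 < B12Normalization.stepBal 2 (F.L : ℝ) := B12Normalization.stepBal_pos (by norm_num) (by exact_mod_cast F.hL.2)
  have hs : 0 < θ.cβ * B12Normalization.stepBal 2 F.L := mul_pos hcβ hstep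
  obtain ⟨γ₀, hγ₀, hγ₀le, hrem⟩ := hS _ hs
  obtain ⟨β', hβ', hup⟩ := h₅ F θ hP hθ
  have hcont := h₄ F θ hP hθ
  have hdrift' := oneLoopDrift_const_mul' hdrift θ.cβ
  exact endpointExistence_of_drift_constRemainder (Node00.datumOfRecord₁₃SepCoPH F 2 θ hP).fwd hγ₀ hdrift' hrem le_rfl hβ'
    (fun k => (hcont k).mono (box_mono hγ₀le k)) (fun k v hv => hup k v (box_mono hγ₀le k hv))

/-- sanity: the exponential-form composition is an instance of the minimal-form one. [folklore] -/
example (h₁ : D1AtNEverySlopeJets) (hT : ThresholdInsensitive13) (hF : FrozenFamilyNamedJets13) (h₄ : ContRecord13) (h₅ : UpperRecord13) :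
    Summit.QuantumFields.YangMills.Theses.BalabanUVNodes.EndpointGivenBR13SepCoPH :=
  EndpointGivenBR13SepCoPH_of_thresholdSlideNmin h₁ (thresholdCorner_of_insensitive hT) hF h₄ h₅

end MinimalForm

/-! ## §8 FIRST RUNGS of (TI-min) (CRIT-1 g3 §5 «first rung = the k = 0 one-step annulus lemma (M); per-scale version (fixed k, no uniformity) M-sized;
the XL part is k-UNIFORMITY»): the PER-SCALE form (δ may depend on the scale k — pure one-step∕finite-composition small-coupling analysis, no fading
memory) and its SCALE-ZERO instance (one RT step: the annulus `e ≤ |B′(b)| < θ.ε₂₉` under the first fluctuation measure).  Typed so that a crux-plan seat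
has the ladder `ScaleZero ← PerScale ← Corner` by name; (TI-min) is `PerScale` with δ chosen k-free. -/

section Rungs

/-- **(TI-min, PER SCALE)** — for every scale `k` separately (δ may depend on `k`): size M per scale (finite composition of one-step analyticity
estimates; NO k-uniformity). [conjecture] -/
def ThresholdCornerPerScale13 : Prop :=
  ∀ (F : T4Family) (θ : Node00.Stage13HParams F 2) (hP : θ.Provisos₁₃SepCoPH F 2), θ.Admissible F 2 →
    ∀ e : ℝ, 0 < e → e ≤ θ.ε₂₉ → ∀ η : ℝ, 0 < η → ∀ k : ℕ, ∃ δ : ℝ, 0 < δ ∧ ∀ γ' : ℝ, 0 < γ' → γ' ≤ δ → γ' ≤ θ.γ →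
      ∀ (p : Fin (k + 1) → ℝ), p ∈ B12Beta.HistBox γ' k → |betaAt F θ θ.ε₂₉ k p - betaAt F θ e k p| ≤ η

/-- **(TI-min, SCALE ZERO) — THE ONE-STEP ANNULUS LEMMA** (first rung, size M): after ONE renormalization transformation from the bare Wilson action, the
β read at thresholds `θ.ε₂₉` and `e` differ by at most `η` once the bare coupling `p 0 ≤ δ(e, η)`. [conjecture] -/
def ThresholdCornerScaleZero13 : Prop :=
  ∀ (F : T4Family) (θ : Node00.Stage13HParams F 2) (hP : θ.Provisos₁₃SepCoPH F 2), θ.Admissible F 2 →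
    ∀ e : ℝ, 0 < e → e ≤ θ.ε₂₉ → ∀ η : ℝ, 0 < η → ∃ δ : ℝ, 0 < δ ∧ ∀ γ' : ℝ, 0 < γ' → γ' ≤ δ → γ' ≤ θ.γ →
      ∀ (p : Fin (0 + 1) → ℝ), p ∈ B12Beta.HistBox γ' 0 → |betaAt F θ θ.ε₂₉ 0 p - betaAt F θ e 0 p| ≤ η

/-- the ladder, top to middle: k-uniform ⟹ per scale. [folklore] -/
theorem cornerPerScale_of_corner (h : ThresholdCorner13) : ThresholdCornerPerScale13 :=
  fun F θ hP hθ e he heε η hη k =>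
    (h F θ hP hθ e he heε η hη).imp fun _δ hδ => ⟨hδ.1, fun γ' hγ' hγ'δ hγ'γ p hp => hδ.2 γ' hγ' hγ'δ hγ'γ k p hp⟩

/-- the ladder, middle to bottom: per scale ⟹ scale zero. [folklore] -/
theorem cornerScaleZero_of_perScale (h : ThresholdCornerPerScale13) : ThresholdCornerScaleZero13 :=
  fun F θ hP hθ e he heε η hη => h F θ hP hθ e he heε η hη 0

end Rungs



/-! ## §9 EDITION 5 (gen 3, 2026-08-28) — THE RUN-WISE RE-KEY REQUIRED BY CRIT-1 g4's BN-F ADDENDUM, IN THE FULL-PREFIX KEYING OF SKELETON v5 (DECISION №204)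
CRIT-1 g4 `CRIT-1-BNF-addendum.md` (a76479c972ec) §2 row «idea-1»: (TI-min), (FFᴺ), (C), (UP) were box-wide ∀k-at-fixed-level letters, HIT ×4 by idea-5 g3's BN-F («the history
box is a gauge-fixing box»; print's k-uniform bounds are stated along in-window runs `0 < g_j ≤ γ, j ≤ k`, [I] Thm 3 p. 264 L31–34); REQUIRED RE-KEY before seating, price unchanged.
Plan g82's registered skeleton v5 (`D82-K2V5/K2Skeleton13SepCoPHv5.lean` 16e2ea6200bb4554, 02:22:53Z; DECISION-204.md): every K2⁷ stub is keyed on the crux's FULL hypothesis prefix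
`∀ F θ hP, (θ.ZhUnity F 2 ∧ θ.SlotsNondegenerate₁₃ F 2) → θ.Admissible F 2 → B16.EndStatementBPrinted D.C → Window13 F θ hP → …` and compositions are POINTWISE.  The texts below
adopt BOTH: they quantify only over the in-window run prefixes of the datum's own construction (`RGEqH n D.βfun gs ∧ Step.InInterval γ′ n gs`, `k ≤ n` — UV-faithful histories), read
(C) on survivor sets, in the currency of DEF-1 g3's tree letter p596574 `Theorems/BalabanUVNodesK2NamedJetsRunRemAt.lean` (`RunConstRemainder`, `SurvCont`, `RunRemAt`), carry v5's
prefix verbatim (`Window13` = v5 :214 verbatim), and compose to the crux decl BY NAME pointwise through p596574's `endpointExistence_of_runRemAt_drift` (Gaps `EndSurvivorCensus`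
`_locUpper` road).  Consequences, all kernel-checked below: (i) the (UP) stub `UpperRecord13` DISAPPEARS (the `_locUpper` road takes per-level upper bounds from the remainder letter
itself, `survUpper_of_runConstRemainder`); (ii) the (D1) stub is the ANCHOR-KEYED text `D1AtAnchorJets13` (CRIT-1 addendum §3 T2 = v5's stub 1′ text with the hypothesis
`RemAt F κ θ hP θ.cβ` replaced by its `ScaleAnchor` conjunct; a run-wise every-slope package no longer pins numbers, so the per-scale anchor is its own M-sized stub `AnchorJets13`
— CRIT-2 v5 LINE 2 (B) «anchor stub = the `ScaleAnchor` conjunct alone» — and (FFᴺ)ᴿ is keyed ON THE ANCHOR's numbers); (iii) every ed.5 text is WEAKER BY NAME than its ed.4 box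
text (§9b: `runThresholdCorner_of_thresholdCorner`, `runFrozenFamilyAnchored_of_corner`, `anchorJets_of_corner`, `contRun_of_contRecord13`, sanity `example`).  DECLARED READING
(a BN-F (N2)-type point, stated not hidden): in (TI-min)ᴿ and (FFᴺ)ᴿ the MEMBER `betaAt F θ e` is evaluated at the RECORD's in-window run prefixes — the natural comparison (two
cut-offs, SAME coupling labels, UV-faithful histories), NOT the member's own (0.20)-runs; a supplier reading print's Thm 3 for the member machine works label-wise on small UV-faithful
histories (intended road) or adds a member-run ⟶ record-run transfer.  HONEST: hypothesis SHAPES + bookkeeping; nothing of Bałaban asserted; K2⁷ OPEN; Clay NOT touched. -/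

section RunWise

open Summit.QuantumFields.YangMills.Theorems.BalabanUVNodesK2JsOfRecord (StepColourData beta0OfJs)
open Summit.QuantumFields.YangMills.Theorems.BalabanUVNodesK2NamedJetsRemAt (ScaleAnchor)
open Summit.QuantumFields.YangMills.Theorems.BalabanUVNodesK2NamedJetsRunRemAt
  (RunConstRemainder SurvCont RunRemAt endpointExistence_of_runRemAt_drift)
open Literature.MathematicalPhysics.QuantumFieldTheory.Balaban1983to89.Beta.Drift (OneLoopDrift)

/-- K2⁷'s WINDOW hypothesis at `(F, θ, hP)`, VERBATIM from the crux text (= skeleton v5 :214 `Window13`, part of every stub's prefix under DECISION №204). -/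
def Window13 (F : T4Family) (θ : Node00.Stage13HParams F 2) (hP : θ.Provisos₁₃SepCoPH F 2) : Prop :=
  ∃ γ₁ : ℝ, 0 < γ₁ ∧ ∀ γ : ℝ, 0 < γ → γ ≤ γ₁ → ∃ P : B12.RunParams, 1 ≤ P.K ∧ ((Node00.datumOfRecord₁₃SepCoPH F 2 θ hP).C P).flow.InInterval γ P.K

/-- **THE RUN-WISE RATE-FREE JUNCTION** (generic; the run twin of `slide_junction_min`): along the in-window runs of a generator `β`, if a compared history-β `βr` is within
every `η` of the member `βe e` on all runs of sufficiently small level (member by member, uniformly in the scale) and for every `r > 0` some member is within `r` of `b` on the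
runs of some level, then for every `s > 0` the compared `βr` is within `s` of `b` along the runs of some level `γ₀ ≤ γ`. [folklore] -/
theorem slide_junction_run {β βr : HBeta} {βe : ℝ → HBeta} {b : ℕ → ℝ} {ε γ : ℝ}
    (hTI : ∀ e : ℝ, 0 < e → e ≤ ε → ∀ η : ℝ, 0 < η → ∃ δ : ℝ, 0 < δ ∧ ∀ γ' : ℝ, 0 < γ' → γ' ≤ δ → γ' ≤ γ →
      ∀ (n : ℕ) (gs : ℕ → ℝ), RGEqH n β gs → Step.InInterval γ' n gs →
        ∀ k, k ≤ n → |βr k (prefixOf gs k) - βe e k (prefixOf gs k)| ≤ η)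
    (hFF : ∀ r : ℝ, 0 < r → ∃ e : ℝ, 0 < e ∧ e ≤ ε ∧ ∃ γe : ℝ, 0 < γe ∧ γe ≤ γ ∧
      ∀ (n : ℕ) (gs : ℕ → ℝ), RGEqH n β gs → Step.InInterval γe n gs →
        ∀ k, k ≤ n → |βe e k (prefixOf gs k) - b k| ≤ r) :
    ∀ s : ℝ, 0 < s → ∃ γ₀ : ℝ, 0 < γ₀ ∧ γ₀ ≤ γ ∧
      ∀ (n : ℕ) (gs : ℕ → ℝ), RGEqH n β gs → Step.InInterval γ₀ n gs →
        ∀ k, k ≤ n → |βr k (prefixOf gs k) - b k| ≤ s := by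
  intro s hs
  obtain ⟨e, he, heε, γe, hγe, hγeγ, hFFe⟩ := hFF (s / 2) (by positivity)
  obtain ⟨δ, hδ, hTIe⟩ := hTI e he heε (s / 2) (by positivity)
  have hγ₀pos : 0 < min γe δ := lt_min hγe hδ
  have hγ₀γ : min γe δ ≤ γ := (min_le_left _ _).trans hγeγ
  refine ⟨min γe δ, hγ₀pos, hγ₀γ, fun n gs hrg hI k hk => ?_⟩
  have hIe : Step.InInterval γe n gs := fun j hj => ⟨(hI j hj).1, (hI j hj).2.trans (min_le_left _ _)⟩
  have h1 := hTIe _ hγ₀pos (min_le_right _ _) hγ₀γ n gs hrg hI k hk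
  have h2 := hFFe n gs hrg hIe k hk
  calc |βr k (prefixOf gs k) - b k|
        ≤ |βr k (prefixOf gs k) - βe e k (prefixOf gs k)| + |βe e k (prefixOf gs k) - b k| := abs_sub_le _ _ _
    _ ≤ s / 2 + s / 2 := add_le_add h1 h2
    _ = s := by ring

/-- **(A) THE PER-SCALE ANCHOR ALONE, at DEF-1's named numbers, κ AFTER θ, `θ.cβ` carried, full-prefix keyed** (CRIT-2 v5 LINE 2 (B) shape = the `ScaleAnchor` conjunct of
the letters `RemAt` ∕ `RunRemAt`): at every tuple carrying K2⁷'s hypotheses SOME colour datum κ whose scaled one-loop numbers are the corner values of the record's β, scale by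
scale (no k-uniformity: (2.13) p. 268 «vanishes at g_k = 0» at constant grade + the identification of the record's one-loop numbers).  Box-wise by design (BN-F NOT HIT: DEF-1 B1,
CRIT-1 addendum §3); immune to `TwoBaseHistories` (no `v₀`-`limUnder` value named) and to `TwoNormalisations` (κ per tuple, `θ.cβ` carried).  Size M per scale.
[cite: Balaban1987RG1, (2.12)–(2.13) p.268 and (1.22) p.264] -/
def AnchorJets13 : Prop :=
  ∀ (F : T4Family) (θ : Node00.Stage13HParams F 2) (hP : θ.Provisos₁₃SepCoPH F 2), (θ.ZhUnity F 2 ∧ θ.SlotsNondegenerate₁₃ F 2) → θ.Admissible F 2 →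
    B16.EndStatementBPrinted (Node00.datumOfRecord₁₃SepCoPH F 2 θ hP).C → Window13 F θ hP →
    ∃ κ : StepColourData, ScaleAnchor (Node00.datumOfRecord₁₃SepCoPH F 2 θ hP).βfun (fun k => θ.cβ * beta0OfJs F κ k)

/-- **(TI-min)ᴿ k-UNIFORM THRESHOLD-CONTINUITY AT THE CORNER, MEMBER BY MEMBER, ALONG THE RECORD's IN-WINDOW RUNS** (ed.5 registration form of the comparison, full-prefix keyed):
for every member `0 < e ≤ θ.ε₂₉` and every `η > 0` there is `δ > 0` such that along every in-window run of the datum's construction of level `γ′ ≤ δ`, `γ′ ≤ θ.γ`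
(`RGEqH n D.βfun gs ∧ Step.InInterval γ′ n gs`), at every prefix `k ≤ n`, the record's merged β and the member's differ by at most `η` — uniformly in `n, k` (the k-uniformity is the
whole content; no rate; no uniformity in `e`).  The member is read at the record's run prefixes (declared reading, §9 header).  NOT PRINTED; size XL; ownerless. [conjecture] -/
def RunThresholdCorner13 : Prop :=
  ∀ (F : T4Family) (θ : Node00.Stage13HParams F 2) (hP : θ.Provisos₁₃SepCoPH F 2), (θ.ZhUnity F 2 ∧ θ.SlotsNondegenerate₁₃ F 2) → θ.Admissible F 2 →
    B16.EndStatementBPrinted (Node00.datumOfRecord₁₃SepCoPH F 2 θ hP).C → Window13 F θ hP →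
    ∀ e : ℝ, 0 < e → e ≤ θ.ε₂₉ → ∀ η : ℝ, 0 < η → ∃ δ : ℝ, 0 < δ ∧ ∀ γ' : ℝ, 0 < γ' → γ' ≤ δ → γ' ≤ θ.γ →
      ∀ (n : ℕ) (gs : ℕ → ℝ), RGEqH n (Node00.datumOfRecord₁₃SepCoPH F 2 θ hP).βfun gs → Step.InInterval γ' n gs →
        ∀ k, k ≤ n → |betaAt F θ θ.ε₂₉ k (prefixOf gs k) - betaAt F θ e k (prefixOf gs k)| ≤ η

/-- **(FFᴺ)ᴿ PRINT's ε₁-FROZEN REMAINDER BOUND ALONG THE OPEN-LETTER FAMILY, RUN-WISE, KEYED ON THE ANCHOR's NUMBERS, full-prefix keyed**: at every tuple carrying K2⁷'s hypotheses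
and every colour datum κ that anchors the record's β (hypothesis `ScaleAnchor … (θ.cβ • beta0OfJs F κ)` — the members' corner values ARE the record's, the (2.9) cut-off being invisible
at zero coupling), for every `r > 0` SOME member `0 < e ≤ θ.ε₂₉` is within `r` of `θ.cβ · beta0OfJs F κ k` along every in-window run of the datum's construction of SOME level
`γ_e ≤ θ.γ`, at every prefix (print's frozen product `ε₁(e)·K_rem ≤ r` for the member machine on small UV-faithful histories: [II] Lemma 3 (2.38) → [I] (5.10) → (1.22), constants
k-free; what a prover may USE here beyond ed.4: `hB` = print's Thm-1 package (B) at the tuple, `hwin`).  Size L–XL ((D4) crew's open-letter deliverable, run-wise).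
[cite: Balaban1988RG2Cluster, Lemma 3 (2.38) p.20; Balaban1987RG1, (5.10) p.293, (1.22) p.264, Thm 3 p.264] -/
def RunFrozenFamilyAnchored13 : Prop :=
  ∀ (F : T4Family) (κ : StepColourData) (θ : Node00.Stage13HParams F 2) (hP : θ.Provisos₁₃SepCoPH F 2), (θ.ZhUnity F 2 ∧ θ.SlotsNondegenerate₁₃ F 2) →
    θ.Admissible F 2 → B16.EndStatementBPrinted (Node00.datumOfRecord₁₃SepCoPH F 2 θ hP).C → Window13 F θ hP →
    ScaleAnchor (Node00.datumOfRecord₁₃SepCoPH F 2 θ hP).βfun (fun k => θ.cβ * beta0OfJs F κ k) →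
    ∀ r : ℝ, 0 < r → ∃ e : ℝ, 0 < e ∧ e ≤ θ.ε₂₉ ∧ ∃ γe : ℝ, 0 < γe ∧ γe ≤ θ.γ ∧
      ∀ (n : ℕ) (gs : ℕ → ℝ), RGEqH n (Node00.datumOfRecord₁₃SepCoPH F 2 θ hP).βfun gs → Step.InInterval γe n gs →
        ∀ k, k ≤ n → |betaAt F θ e k (prefixOf gs k) - θ.cβ * beta0OfJs F κ k| ≤ r

/-- **(C)ᴿ RUN-WISE CONTINUITY AT THE RECORD, full-prefix keyed**: at every level `0 < γ₀ ≤ θ.γ` the survivor-continuity letter `SurvCont` of p596574 ∕ Gaps `EndSurvivorCensus` for the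
record's β (weaker BY NAME than the box letter `ContRecord13` = v4∕v5 `stub_cont13` up to the prefix: `contRun_of_contRecord13`).  Size M. [cite: Balaban1987RG1, §1 pp.263–264] -/
def ContRun13 : Prop :=
  ∀ (F : T4Family) (θ : Node00.Stage13HParams F 2) (hP : θ.Provisos₁₃SepCoPH F 2), (θ.ZhUnity F 2 ∧ θ.SlotsNondegenerate₁₃ F 2) → θ.Admissible F 2 →
    B16.EndStatementBPrinted (Node00.datumOfRecord₁₃SepCoPH F 2 θ hP).C → Window13 F θ hP →
    ∀ γ₀ : ℝ, 0 < γ₀ → γ₀ ≤ θ.γ → SurvCont (Node00.datumOfRecord₁₃SepCoPH F 2 θ hP).βfun γ₀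

/-- **(D1-A) ROW (D1) AT THE RECORD, ANCHOR-KEYED, full-prefix keyed** — CRIT-1 addendum §3 T2 («THE (D1) stub», shared with line 1′) = skeleton v5's stub 1′ text `D1AtShadowingJets`
with the hypothesis `RemAt F κ θ hP θ.cβ` replaced by its `ScaleAnchor` conjunct (BN-F-robust: an anchor is box-wise per scale by nature); = p596574's `hD1` up to the v5 prefix.
USE FORM `d1AtAnchorJets13_of_d1Drift_all`.  Size L. [cite: Balaban1987RG1, (1.3) p.260 with (2.12)–(2.13) p.268] -/
def D1AtAnchorJets13 : Prop :=
  ∀ (F : T4Family) (κ : StepColourData) (θ : Node00.Stage13HParams F 2) (hP : θ.Provisos₁₃SepCoPH F 2), (θ.ZhUnity F 2 ∧ θ.SlotsNondegenerate₁₃ F 2) →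
    θ.Admissible F 2 → B16.EndStatementBPrinted (Node00.datumOfRecord₁₃SepCoPH F 2 θ hP).C → Window13 F θ hP →
    ScaleAnchor (Node00.datumOfRecord₁₃SepCoPH F 2 θ hP).βfun (fun k => θ.cβ * beta0OfJs F κ k) →
    ∃ A : ℝ, OneLoopDrift (B12Normalization.stepBal 2 F.L) A (beta0OfJs F κ)

/-- USE FORM of (D1-A): «row (D1) at every colour datum» discharges it (hypotheses unread). [folklore] -/
theorem d1AtAnchorJets13_of_d1Drift_all
    (h : ∀ (F : T4Family) (κ : StepColourData), ∃ A : ℝ, OneLoopDrift (B12Normalization.stepBal 2 F.L) A (beta0OfJs F κ)) :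
    D1AtAnchorJets13 := fun F κ _θ _hP _hU _hθ _hB _hwin _hanch => h F κ

/-- a box-wide every-slope package pins the numbers scale by scale: `ShadowN ⟹ ScaleAnchor`. [folklore] -/
theorem scaleAnchor_of_shadowN {F : T4Family} {κ : StepColourData} {θ : Node00.Stage13HParams F 2} {hP : θ.Provisos₁₃SepCoPH F 2}
    (h : ShadowN F κ θ hP) : ScaleAnchor (Node00.datumOfRecord₁₃SepCoPH F 2 θ hP).βfun (fun k => θ.cβ * beta0OfJs F κ k) := by
  intro k δ hδ
  obtain ⟨γ₀, hγ₀, -, hb⟩ := h δ hδ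
  exact ⟨γ₀, hγ₀, fun p hp => hb k p hp⟩

/-- **(TI-min)ᴿ ∧ (FFᴺ)ᴿ ∧ (C)ᴿ AT AN ANCHORING κ ⟹ THE RUN LETTER `RunRemAt F κ θ hP θ.cβ`** (pointwise, at a tuple carrying K2⁷'s hypotheses): the run-wise constant remainder
with the seam `s := θ.cβ · stepBal 2 F.L` (cap met with equality) from the run junction — on in-window prefixes the datum's β IS the merged β (`betaOfMerged_of_mem`) —, the anchor
itself, and survivor continuity at the produced level. [folklore] -/
theorem runRemAt_of_runSlide_at (hT : RunThresholdCorner13) (hF : RunFrozenFamilyAnchored13) (hC : ContRun13)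
    (F : T4Family) (θ : Node00.Stage13HParams F 2) (hP : θ.Provisos₁₃SepCoPH F 2) (hU : θ.ZhUnity F 2 ∧ θ.SlotsNondegenerate₁₃ F 2) (hθ : θ.Admissible F 2)
    (hB : B16.EndStatementBPrinted (Node00.datumOfRecord₁₃SepCoPH F 2 θ hP).C) (hwin : Window13 F θ hP)
    (κ : StepColourData) (hanch : ScaleAnchor (Node00.datumOfRecord₁₃SepCoPH F 2 θ hP).βfun (fun k => θ.cβ * beta0OfJs F κ k)) :
    RunRemAt F κ θ hP θ.cβ := by
  have hcβ : 0 < θ.cβ := hθ.toStage9.chart.1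
  have hstep : 0 < B12Normalization.stepBal 2 (F.L : ℝ) := B12Normalization.stepBal_pos (by norm_num) (by exact_mod_cast F.hL.2)
  have hs : 0 < θ.cβ * B12Normalization.stepBal 2 F.L := mul_pos hcβ hstep
  obtain ⟨γ₀, hγ₀, hγ₀le, hrun⟩ :=
    slide_junction_run (β := (Node00.datumOfRecord₁₃SepCoPH F 2 θ hP).βfun) (βr := betaAt F θ θ.ε₂₉) (βe := betaAt F θ)
      (b := fun k => θ.cβ * beta0OfJs F κ k) (hT F θ hP hU hθ hB hwin) (hF F κ θ hP hU hθ hB hwin hanch) _ hs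
  refine ⟨γ₀, θ.cβ * B12Normalization.stepBal 2 F.L, hγ₀, hγ₀le, le_rfl, ?_, hanch, hC F θ hP hU hθ hB hwin γ₀ hγ₀ hγ₀le⟩
  intro n gs hrg hI k hk
  have hpbox : prefixOf gs k ∈ Box θ.γ k := mem_box.mpr fun i =>
    ⟨(hI i ((Nat.lt_succ_iff.mp i.isLt).trans hk)).1, (hI i ((Nat.lt_succ_iff.mp i.isLt).trans hk)).2.trans hγ₀le⟩
  letI := θ.instVβ₁; letI := θ.instVβ₂; letI := θ.instιβ
  have e : (Node00.datumOfRecord₁₃SepCoPH F 2 θ hP).βfun k (prefixOf gs k) = betaAt F θ θ.ε₂₉ k (prefixOf gs k) :=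
    Node00.betaOfMerged_of_mem _ _ _ hpbox
  rw [e]
  exact hrun n gs hrg hI k hk

/-- … hence, with the anchor stub, the RUN-WISE 2ᴮ″ TEXT in v5 keying: `∃ κ, RunRemAt F κ θ hP θ.cβ` at every tuple carrying K2⁷'s hypotheses (= CRIT-1's asked one-token swap
`RemAt ↦ RunRemAt` of v5's `RemAtSomeJets`). [folklore] -/
theorem runRemAtSomeJetsK_of_runSlide (hA : AnchorJets13) (hT : RunThresholdCorner13) (hF : RunFrozenFamilyAnchored13) (hC : ContRun13) :
    ∀ (F : T4Family) (θ : Node00.Stage13HParams F 2) (hP : θ.Provisos₁₃SepCoPH F 2), (θ.ZhUnity F 2 ∧ θ.SlotsNondegenerate₁₃ F 2) → θ.Admissible F 2 →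
      B16.EndStatementBPrinted (Node00.datumOfRecord₁₃SepCoPH F 2 θ hP).C → Window13 F θ hP →
      ∃ κ : StepColourData, RunRemAt F κ θ hP θ.cβ :=
  fun F θ hP hU hθ hB hwin => (hA F θ hP hU hθ hB hwin).imp fun κ hanch => runRemAt_of_runSlide_at hT hF hC F θ hP hU hθ hB hwin κ hanch

/-- **★ EDITION 5's COMPOSITION (kernel, no sorry, POINTWISE as in v5): `D1AtAnchorJets13 → AnchorJets13 → RunThresholdCorner13 → RunFrozenFamilyAnchored13 → ContRun13 → K2⁷`**,
the crux decl BY NAME: at a tuple carrying the crux's hypotheses, (A) gives κ and its anchor, (TI-min)ᴿ∘(FFᴺ)ᴿ∘(C)ᴿ the run letter at κ, (D1-A) the bare drift at κ (keyed on the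
anchor), and p596574's `endpointExistence_of_runRemAt_drift` (Gaps `EndSurvivorCensus` `_locUpper` road; NO (UP) stub) concludes.  CONDITIONAL on the five displayed hypothesis
shapes; K2⁷ NOT closed; nothing of Bałaban asserted. [folklore] -/
theorem EndpointGivenBR13SepCoPH_of_runThresholdSlide (h₁ : D1AtAnchorJets13) (hA : AnchorJets13) (hT : RunThresholdCorner13)
    (hF : RunFrozenFamilyAnchored13) (hC : ContRun13) :
    Summit.QuantumFields.YangMills.Theses.BalabanUVNodes.EndpointGivenBR13SepCoPH := by
  intro F θ hP hU hθ hB hwin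
  obtain ⟨κ, hanch⟩ := hA F θ hP hU hθ hB hwin
  obtain ⟨A, hdrift⟩ := h₁ F κ θ hP hU hθ hB hwin hanch
  exact endpointExistence_of_runRemAt_drift F κ θ hP (runRemAt_of_runSlide_at hT hF hC F θ hP hU hθ hB hwin κ hanch) hdrift

/-! ### §9b BOX ⟹ RUNS: every ed.5 text is weaker BY NAME than its ed.4 box text (and than the `Admissible`-only keying) -/

/-- (TI-min) ⟹ (TI-min)ᴿ: in-window run prefixes of level `γ′` lie in `HistBox γ′`; the extra prefix hypotheses are discarded. [folklore] -/
theorem runThresholdCorner_of_thresholdCorner (h : ThresholdCorner13) : RunThresholdCorner13 := by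
  intro F θ hP _hU hθ _hB _hwin e he heε η hη
  obtain ⟨δ, hδ, hbox⟩ := h F θ hP hθ e he heε η hη
  exact ⟨δ, hδ, fun γ' hγ' hγ'δ hγ'γ n gs _hrg hI k hk =>
    hbox γ' hγ' hγ'δ hγ'γ k (prefixOf gs k) fun i => hI i ((Nat.lt_succ_iff.mp i.isLt).trans hk)⟩

/-- `ContRecord13` (box `BetaContH θ.γ`, v4 text) ⟹ `ContRun13` (survivor sets, every level in the window). [folklore] -/
theorem contRun_of_contRecord13 (h : ContRecord13) : ContRun13 := by
  intro F θ hP _hU hθ _hB _hwin γ₀ hγ₀ hγ₀le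
  have hcont := h F θ hP hθ
  exact SurvCont.of_betaContH hγ₀ fun k => (hcont k).mono (box_mono hγ₀le k)

/-- (TI-min) ∘ (FFᴺ) (box texts of ed.4) ⟹ the anchor (A). [folklore] -/
theorem anchorJets_of_corner (hT : ThresholdCorner13) (hF : FrozenFamilyNamedJets13) : AnchorJets13 :=
  fun F θ hP _hU hθ _hB _hwin => (shadowN_of_corner hT hF F θ hP hθ).imp fun _κ hS => scaleAnchor_of_shadowN hS

/-- (TI-min) ∘ (FFᴺ) (box texts of ed.4) ⟹ (FFᴺ)ᴿ keyed on ANY anchoring κ′: the box package at (FFᴺ)'s κ anchors the record, anchors determine their numbers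
(`ScaleAnchor.eq_of_smul`, `θ.cβ ≠ 0`), so `beta0OfJs F κ = beta0OfJs F κ′` and the member bounds transfer to the run prefixes. [folklore] -/
theorem runFrozenFamilyAnchored_of_corner (hT : ThresholdCorner13) (hF : FrozenFamilyNamedJets13) :
    RunFrozenFamilyAnchored13 := by
  intro F κ' θ hP _hU hθ _hB _hwin hanch' r hr
  obtain ⟨κ, hFF⟩ := hF F θ hP hθ
  have hcβ : 0 < θ.cβ := hθ.toStage9.chart.1
  have hanch : ScaleAnchor (Node00.datumOfRecord₁₃SepCoPH F 2 θ hP).βfun (fun k => θ.cβ * beta0OfJs F κ k) := by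
    intro k δ hδ
    obtain ⟨γ₀, hγ₀, hγ₀le, hsmall⟩ :=
      slide_junction_min (β := betaAt F θ θ.ε₂₉) (βe := betaAt F θ) (b := fun k => θ.cβ * beta0OfJs F κ k) (hT F θ hP hθ) hFF δ hδ
    refine ⟨γ₀, hγ₀, fun p hp => ?_⟩
    have hpbox : p ∈ Box θ.γ k := mem_box.mpr fun i => ⟨(hp i).1, (hp i).2.trans hγ₀le⟩
    letI := θ.instVβ₁; letI := θ.instVβ₂; letI := θ.instιβ
    have e : (Node00.datumOfRecord₁₃SepCoPH F 2 θ hP).βfun k p = betaAt F θ θ.ε₂₉ k p :=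
      Node00.betaOfMerged_of_mem _ _ _ hpbox
    rw [e]
    exact hsmall k p hp
  have hκ : beta0OfJs F κ = beta0OfJs F κ' := ScaleAnchor.eq_of_smul hcβ.ne' hanch hanch'
  obtain ⟨e, he, heε, γe, hγe, hγeγ, hFFe⟩ := hFF r hr
  refine ⟨e, he, heε, γe, hγe, hγeγ, fun n gs _hrg hI k hk => ?_⟩
  rw [← hκ]
  exact hFFe k (prefixOf gs k) fun i => hI i ((Nat.lt_succ_iff.mp i.isLt).trans hk)

/-- the anchor-keyed (D1) text gives ed.4's every-slope-keyed one at tuples carrying the crux's hypotheses — recorded as the pointwise bridge used by the sanity example below;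
conversely «row (D1) ∀κ» discharges both (`d1AtAnchorJets13_of_d1Drift_all`, `d1AtNEverySlopeJets_of_d1Drift_all`). [folklore] -/
theorem d1_at_anchor_of_shadowN (h₁ : D1AtAnchorJets13) (F : T4Family) (κ : StepColourData) (θ : Node00.Stage13HParams F 2) (hP : θ.Provisos₁₃SepCoPH F 2)
    (hU : θ.ZhUnity F 2 ∧ θ.SlotsNondegenerate₁₃ F 2) (hθ : θ.Admissible F 2) (hB : B16.EndStatementBPrinted (Node00.datumOfRecord₁₃SepCoPH F 2 θ hP).C)
    (hwin : Window13 F θ hP) (hS : ShadowN F κ θ hP) : ∃ A : ℝ, OneLoopDrift (B12Normalization.stepBal 2 F.L) A (beta0OfJs F κ) :=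
  h₁ F κ θ hP hU hθ hB hwin (scaleAnchor_of_shadowN hS)

/-- sanity: ed.4's box texts (with the anchor-keyed (D1) text, and WITHOUT `UpperRecord13`) give K2⁷ through the ed.5 run-wise composition. [folklore] -/
example (h₁ : D1AtAnchorJets13) (hT : ThresholdCorner13) (hF : FrozenFamilyNamedJets13) (h₄ : ContRecord13) :
    Summit.QuantumFields.YangMills.Theses.BalabanUVNodes.EndpointGivenBR13SepCoPH :=
  EndpointGivenBR13SepCoPH_of_runThresholdSlide h₁ (anchorJets_of_corner hT hF) (runThresholdCorner_of_thresholdCorner hT)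
    (runFrozenFamilyAnchored_of_corner hT hF) (contRun_of_contRecord13 h₄)

end RunWise

/-! ## §10 EDITION 6 (gen 4, 2026-08-28) — ALIGNMENT WITH THE REGISTERED SKELETON v6 (plan g82 `D82-K2V6/K2Skeleton13SepCoPHv6.lean` sha16 5a75a2378c79b303; director-ym №206 GO; CRIT-1 g4 `CRIT-1-v6-linecheck.md` PASS)

v6 registers exactly TWO stubs for LINE 1′ and nothing else: `stub_d1AnchoredJets13 : D1AtAnchoredJets` (1ᴬ, size L — dealt to the b2b (D1) desks by №206) and
`stub_runRemNamedJets13 : RunRemAtSomeJets` (2ᴮ″, size XL — «stays the nodeO cell's object (P1∕P3∕DEF-1 + idea seats)»), concluded POINTWISE by v6 :339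
`EndpointGivenBR13SepCoPH_of_anchoredJetsRun` (tree `endpointExistence_of_runRemAt_drift`, p596574 :213, inside).  The kit file is not importable from the tree, so its two
registered TEXTS are copied VERBATIM into the sub-namespace `V6` below, over this file's `Window13` (body byte-identical to v6 :241–:242).

RESULT (kernel, no sorry; nothing new asserted, no stub text touched):
* ed.5's (D1-A) text IS v6's registered 1ᴬ text: `d1AtAnchorJets13_iff_v6 : D1AtAnchorJets13 ↔ V6.D1AtAnchoredJets := Iff.rfl`;
* idea-1's run-wise road is a SUPPLIER ROAD OF v6's XL STUB 2ᴮ″ BY NAME: `runRemAtSomeJets_v6_of_runSlide : AnchorJets13 → RunThresholdCorner13 → RunFrozenFamilyAnchored13 →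
  ContRun13 → V6.RunRemAtSomeJets` (term = ed.5's `runRemAtSomeJetsK_of_runSlide`; the two Props are definitionally equal) — the THIRD typed supplier road of `stub_runRemNamedJets13`
  next to idea-7 ed.3 `runRemAtSomeJetsV5_of_u3TripleK_anchorK` and idea-5 ed.2.3 `runRemAtSomeJets_of_modRowsSomeJetsK`, with a DISTINCT payer for the remainder smallness
  (ε-resolution along the open-letter threshold family + the k-uniform two-threshold corner comparison (TI-min)ᴿ; no g-resolution, no k-rate);
* v6's pair concluder re-proved over the copies (`EndpointGivenBR13SepCoPH_of_v6_pair`, v6 :339's five lines), so that ed.6's composition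
  `EndpointGivenBR13SepCoPH_of_runThresholdSlide_v6 : D1AtAnchorJets13 → AnchorJets13 → RunThresholdCorner13 → RunFrozenFamilyAnchored13 → ContRun13 → K2⁷` FACTORS THROUGH v6's
  REGISTERED PAIR (and agrees with ed.5's direct composition by proof irrelevance).
HONEST: shapes + bookkeeping only; (TI-min)ᴿ NOT PRINTED and ownerless; K2⁷ OPEN; YM mass gap (Clay) NOT proved; R4 closes only the conditional finite-𝕋⁴ rung `BalabanLadder.UV`. -/

section V6Alignment

open Summit.QuantumFields.YangMills.Theorems.BalabanUVNodesK2JsOfRecord (StepColourData beta0OfJs)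
open Summit.QuantumFields.YangMills.Theorems.BalabanUVNodesK2NamedJetsRemAt (ScaleAnchor)
open Summit.QuantumFields.YangMills.Theorems.BalabanUVNodesK2NamedJetsRunRemAt
  (RunConstRemainder SurvCont RunRemAt endpointExistence_of_runRemAt_drift)
open Literature.MathematicalPhysics.QuantumFieldTheory.Balaban1983to89.Beta.Drift (OneLoopDrift)

namespace V6

/-- **v6's REGISTERED STUB 2ᴮ″ TEXT, VERBATIM** (`K2Skeleton13SepCoPHv6.lean` :319–:322, `stub_runRemNamedJets13 : RunRemAtSomeJets`, sha16 5a75a2378c79b303): «rows (D4) ∧ B4 read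
ALONG THE IN-WINDOW RG RUNS of the tuple's own construction — constant remainder with the cap `s ≤ θ.cβ·stepBal 2 F.L`, box ANCHOR, survivor (C) — GIVEN unity, admissibility, (B) and
the window AT THE TUPLE; κ chosen AFTER θ»: `∃ κ, RunRemAt F κ θ hP θ.cβ` (DEF-1's RUN EDITION, tree p596574 :175).  Copied here ONLY to type idea-1's supplier road against the
registered bytes; the registered object is v6's, not this copy.  Size XL (wall = NODE O).
[cite: Balaban1987RG1, Thm 3 p.264, (1.20)–(1.22) p.264, (2.12)–(2.14) p.268, (5.10) p.293; Balaban1988RG2Cluster, (2.41) p.21] -/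
def RunRemAtSomeJets : Prop :=
  ∀ (F : T4Family) (θ : Node00.Stage13HParams F 2) (hP : θ.Provisos₁₃SepCoPH F 2), (θ.ZhUnity F 2 ∧ θ.SlotsNondegenerate₁₃ F 2) → θ.Admissible F 2 →
    B16.EndStatementBPrinted (Node00.datumOfRecord₁₃SepCoPH F 2 θ hP).C → Window13 F θ hP →
    ∃ κ : StepColourData, RunRemAt F κ θ hP θ.cβ

/-- **v6's REGISTERED STUB 1ᴬ TEXT, VERBATIM** (`K2Skeleton13SepCoPHv6.lean` :330–:334, `stub_d1AnchoredJets13 : D1AtAnchoredJets`): «row (D1) at the record, carried by the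
ANCHORING named jets» — at a tuple carrying the crux's hypotheses, whenever a colour datum's `θ.cβ`-scaled named one-loop numbers ANCHOR the record's β scale by scale, the BARE
numbers drift with slope `stepBal 2 F.L`.  Size L (dealt to the b2b (D1) desks, director-ym №206).  [cite: Balaban1987RG1, (1.3) p.260 and (2.12)–(2.13) p.268] -/
def D1AtAnchoredJets : Prop :=
  ∀ (F : T4Family) (κ : StepColourData) (θ : Node00.Stage13HParams F 2) (hP : θ.Provisos₁₃SepCoPH F 2), (θ.ZhUnity F 2 ∧ θ.SlotsNondegenerate₁₃ F 2) → θ.Admissible F 2 →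
    B16.EndStatementBPrinted (Node00.datumOfRecord₁₃SepCoPH F 2 θ hP).C → Window13 F θ hP →
    ScaleAnchor (Node00.datumOfRecord₁₃SepCoPH F 2 θ hP).βfun (fun k => θ.cβ * beta0OfJs F κ k) →
    ∃ A : ℝ, OneLoopDrift (B12Normalization.stepBal 2 F.L) A (beta0OfJs F κ)

end V6

/-- ed.5's (D1-A) text `D1AtAnchorJets13` IS v6's registered 1ᴬ text (same bytes over byte-identical `Window13`s). [folklore] -/
theorem d1AtAnchorJets13_iff_v6 : D1AtAnchorJets13 ↔ V6.D1AtAnchoredJets := Iff.rfl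

/-- **★ idea-1's SUPPLIER ROAD OF v6's XL STUB 2ᴮ″ BY NAME**: (A) ∧ (TI-min)ᴿ ∧ (FFᴺ)ᴿ ∧ (C)ᴿ ⟹ `V6.RunRemAtSomeJets` — the term is ed.5's `runRemAtSomeJetsK_of_runSlide`
(run junction `slide_junction_run` + `betaOfMerged_of_mem` + seam `θ.cβ·stepBal 2 F.L` with cap `le_rfl`, inside `runRemAt_of_runSlide_at`).  What a prover of
`stub_runRemNamedJets13` taking THIS road proves: the four displayed hypothesis texts (§9), of which (TI-min)ᴿ `RunThresholdCorner13` is the XL, NOT PRINTED, ownerless one. [folklore] -/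
theorem runRemAtSomeJets_v6_of_runSlide (hA : AnchorJets13) (hT : RunThresholdCorner13) (hF : RunFrozenFamilyAnchored13) (hC : ContRun13) :
    V6.RunRemAtSomeJets :=
  runRemAtSomeJetsK_of_runSlide hA hT hF hC

/-- v6's POINTWISE PAIR CONCLUDER re-proved over the verbatim copies (v6 :339–:346, same five lines; tree `endpointExistence_of_runRemAt_drift` p596574 :213 inside):
`V6.D1AtAnchoredJets → V6.RunRemAtSomeJets → K2⁷` BY NAME. [folklore] -/
theorem EndpointGivenBR13SepCoPH_of_v6_pair (h₁ : V6.D1AtAnchoredJets) (h₂ : V6.RunRemAtSomeJets) :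
    Summit.QuantumFields.YangMills.Theses.BalabanUVNodes.EndpointGivenBR13SepCoPH := by
  intro F θ hP hU hθ hB hwin
  obtain ⟨κ, hRun⟩ := h₂ F θ hP hU hθ hB hwin
  have hanch := hRun
  obtain ⟨-, -, -, -, -, -, hanch, -⟩ := hanch
  obtain ⟨A, hdrift⟩ := h₁ F κ θ hP hU hθ hB hwin hanch
  exact endpointExistence_of_runRemAt_drift F κ θ hP hRun hdrift

/-- **★ EDITION 6's COMPOSITION, FACTORING THROUGH v6's REGISTERED PAIR (kernel, no sorry)**:
`D1AtAnchorJets13 → AnchorJets13 → RunThresholdCorner13 → RunFrozenFamilyAnchored13 → ContRun13 → K2⁷`, the crux decl BY NAME — (D1-A) = v6's 1ᴬ (`Iff.rfl`), the other four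
supply v6's 2ᴮ″ (`runRemAtSomeJets_v6_of_runSlide`), v6's pair concludes.  CONDITIONAL on the five displayed hypothesis shapes; K2⁷ NOT closed; nothing of Bałaban asserted. [folklore] -/
theorem EndpointGivenBR13SepCoPH_of_runThresholdSlide_v6 (h₁ : D1AtAnchorJets13) (hA : AnchorJets13) (hT : RunThresholdCorner13)
    (hF : RunFrozenFamilyAnchored13) (hC : ContRun13) :
    Summit.QuantumFields.YangMills.Theses.BalabanUVNodes.EndpointGivenBR13SepCoPH :=
  EndpointGivenBR13SepCoPH_of_v6_pair (d1AtAnchorJets13_iff_v6.mp h₁) (runRemAtSomeJets_v6_of_runSlide hA hT hF hC)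

/-- sanity: the v6-factored composition and ed.5's direct one are the same proof of the same Prop (proof irrelevance). [folklore] -/
example (h₁ : D1AtAnchorJets13) (hA : AnchorJets13) (hT : RunThresholdCorner13) (hF : RunFrozenFamilyAnchored13) (hC : ContRun13) :
    EndpointGivenBR13SepCoPH_of_runThresholdSlide_v6 h₁ hA hT hF hC = EndpointGivenBR13SepCoPH_of_runThresholdSlide h₁ hA hT hF hC := rfl

/-- sanity (box road, v6-factored): ed.4's box texts with the anchor-keyed (D1) text give K2⁷ through v6's registered pair. [folklore] -/
example (h₁ : D1AtAnchorJets13) (hT : ThresholdCorner13) (hF : FrozenFamilyNamedJets13) (h₄ : ContRecord13) :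
    Summit.QuantumFields.YangMills.Theses.BalabanUVNodes.EndpointGivenBR13SepCoPH :=
  EndpointGivenBR13SepCoPH_of_runThresholdSlide_v6 h₁ (anchorJets_of_corner hT hF) (runThresholdCorner_of_thresholdCorner hT)
    (runFrozenFamilyAnchored_of_corner hT hF) (contRun_of_contRecord13 h₄)

end V6Alignment



end Summit.QuantumFields.YangMills.Cruxes.EndpointGivenBR13SepCoPH.ThresholdSlide

end
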